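import Mathlib
import Literature.MathematicalPhysics.QuantumFieldTheory.Borinsky2020.TropicalLowerBound
import Literature.MathematicalPhysics.QuantumFieldTheory.Borinsky2020.ConeIntegral
import Literature.MathematicalPhysics.QuantumFieldTheory.Borinsky2020.GeneralizedPermutahedronInterior
import HarnessLib

/-!
# Borinsky's convergence theorem for `I = ∫_{ℙ^{n−1}_{>0}} Π_i a_i^{ν_i}/Π_j b_j^{ρ_j} Ω` (AIHPD 2023 = arXiv:2008.12310, **Theorem 3**: requirements R1, R2, R3 ⇒ the integral converges), with **Lemma 15** (R1 ∧ R2 ⇒ the support-function gap `max_ℬ⟨y,·⟩ − max_𝒜⟨y,·⟩ ≥ ε‖y‖_{ℝⁿ/𝟙ℝ}`), eq. (atrbtr_exp), the finiteness of the tropicalised integral `I^tr`, the tropical probability measure `μ^tr` of eq. (mu_probability) with `I = I^tr ∫ R_{a/b} μ^tr`, and the generalized-permutahedron case (Lemma 16 / Theorem 27 / Corollary 24) — PROVED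

independent recomputation; certified where stated, statistical where stated; no new-physics claim.

CITATION HEADER (venture `QEDPrecision`, cell `pub-qed`, track TROPICAL, LIT seat `pub-qed-trop-lit` gen 25; VALUE-FREE: statements about
ABSTRACT polynomials, polytopes and one parametric integral form — no Feynman graph, no Monte-Carlo value, nothing per word or per Set V
family). ASSEMBLES the convergence theorem that the companion files left open: `TropicalApproximation.lean` (Definitions 1, 2, 6,
Theorem 8a; header "NOT typed: … Theorem 3"), `TropicalLowerBound.lean` (Theorem 8b, Proposition 7, Lemmas 10–11, and
`exists_abs_residual_le` = the sentence of Theorem 3's proof that uses Corollary 9; header "NOT typed: … Theorem 3 and §4–§7 … not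
assembled here"), and — for the generalized-permutahedron case of §6 — `GeneralizedPermutahedronVertex.lean` (Lemma 26) and
`GeneralizedPermutahedronInterior.lean` (Corollary 24). Serves: the track's source sheet `tropical/lit/SOURCES.md` §1.1 / §5 / A24 and ORACLE-MAP §0b clause (i) ("convergence
= Borinsky 2020 Thm 2.3 (R1–R3)" — now a tree theorem), T1/T2/E1 (what "exponent conditions ⇒ convergence of the ENVELOPE" means in the
method paper: `integrable_tropical_of_gap`, R3-free), V3a / `Volkov2016/RayConvergenceCriterion.lean` (a polytope-level sufficient
criterion beside its ray criterion).

Source [Borinsky2020]: M. Borinsky, "Tropical Monte Carlo quadrature for Feynman integrals", Ann. Inst. Henri Poincaré D 10 (2023) 635–685,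
doi:10.4171/aihpd/158 = arXiv:2008.12310v2 (LaTeX e-print held by the cell, HOME `data/lit/sources/.cache/2008.12310/tropical.tex`; theorem
numbers = the e-print's single shared counter as in the companion files; journal concordance (source sheet A4.1): e-print Theorem 3 =
AIHPD Thm 2.3 p. 642, Lemma 15 = Lemma 4.1 p. 652, Lemma 16 = Lemma 4.2 p. 653). VERBATIM. §1.2 eq. (integral) (tex l.221–233): "I =
∫_{ℙ^{n−1}_{>0}} Π_i a_i(x)^{ν_i}/Π_j b_j(x)^{ρ_j} Ω with … the differential form Ω = Σ_{k=1}^n (−1)^{n−k} dx_1/x_1 ∧ … ∧ \widehat{dx_k/x_k}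
∧ … ∧ dx_n/x_n, … the sets of homogeneous polynomials {a_1,a_2,…},{b_1,b_2,…} ⊂ ℂ[x_1,…,x_n], s.t. Σ_i ν_i deg a_i = Σ_j ρ_j deg b_j
(homogeneous), where the coefficients ν_i, ρ_j ∈ ℂ have non-negative real part"; eq. (integral_euler_mellin) (l.237–241): "The integral in
eq. (integral) can be written as an integral over the positive orthant … by picking an affine chart for projective space, for instance
I = ∫_{ℝ^{n−1}_{>0}} (Π_i a_i(x)^{ν_i}/Π_j b_j(x)^{ρ_j})|_{x_n=1} Π_{k=1}^{n−1} dx_k/x_k" and (l.245) "As every non-homogeneous polynomial in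
n−1 variables can be homogenized by introducing a new variable, every generalized Euler-Mellin integral such as the one in
eq. (integral_euler_mellin) is equivalent to an integral of the projective form in eq. (integral)." §2 (l.299): "The Newton polytope
NP_p of a homogeneous polynomial p in n variables is at most (n−1)-dimensional as it is contained in the hyperplane {v ∈ ℝⁿ : ⟨𝟙,v⟩ =
deg p}". **Theorem 3** (l.315–331): "We define the polytopes 𝒜, ℬ ⊂ ℝⁿ as the weighted Minkowski sums 𝒜 = Σ_i (Re ν_i) NP_{a_i},
ℬ = Σ_j (Re ρ_j) NP_{b_j} of the Newton polytopes of the numerator and denominator polynomials {a_i} and {b_j}. The integral in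
eq. (integral) is convergent if (R1) the denominator polytope ℬ is (n−1)-dimensional, (R2) the numerator polytope 𝒜 is contained in the
relative interior of ℬ: 𝒜 ⊂ relint ℬ, (R3) all the denominator polynomials {b_j} are completely non-vanishing on ℙ^{n−1}_{>0}."
Remark 4 (l.333–337): "The condition in eq. (homogeneous) … guarantees that 𝒜 and ℬ both lie in the same hyperplane 𝒜, ℬ ⊂
{v ∈ ℝⁿ : ⟨𝟙,v⟩ = ξ} … in which ℬ is required to be full-dimensional by requirement R1." (l.339): "A similar theorem in the equivalent
context of Euler-Mellin integrals was proven in [Nilsson–Passare] (see also [Berkesch–Forsgård–Passare]). The tropical approximation …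
will lead to an alternative proof of Theorem 3 which we postpone to Section 4." §4 (l.653–666): "we can trivially 'factorize' its
integrand and write it as I = ∫ (Π_i a_i^tr(x)^{Re ν_i}/Π_j b_j^tr(x)^{Re ρ_j}) (Π_i a_i(x)^{ν_i}/a_i^tr(x)^{Re ν_i} / Π_j
b_j(x)^{ρ_j}/b_j^tr(x)^{Re ρ_j}) Ω. The second factor is bounded by Corollary 9 as long as the {b_j} polynomials are completely
non-vanishing. … By Proposition 7 and the definition of the weighted Minkowski sum with x = e^y, Π_i a_i^tr(x)^{Re ν_i}/Π_j
b_j^tr(x)^{Re ρ_j} = exp(Σ_i Re ν_i max_{v∈NP_{a_i}}⟨y,v⟩ − Σ_j Re ρ_j max_{v∈NP_{b_j}}⟨y,v⟩) = exp(max_{v∈𝒜}⟨y,v⟩ − max_{v∈ℬ}⟨y,v⟩)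
(atrbtr_exp). **If 𝒜 and ℬ fulfill the requirements R1 and R2 of Theorem 3, this exponent is falling sufficiently fast for large y for
the integral in eq. (integral) to be convergent.**" **Lemma 15** (l.669–676): "If 𝒜 and ℬ fulfill the requirements R1 and R2 of
Theorem 3, then there is a constant ε > 0 such that max_{v∈ℬ}⟨y,v⟩ − max_{v∈𝒜}⟨y,v⟩ ≥ ε‖y‖_{ℝⁿ/𝟙ℝ} for all y ∈ ℝⁿ/𝟙ℝ, where
‖y‖_{ℝⁿ/𝟙ℝ} = inf_{μ∈ℝ} ‖y + μ𝟙‖ is the norm on the quotient space"; its proof (l.678–687): "As ℬ is full-dimensional in H_ξ (see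
Remark 4) and 𝒜 ⊂ relint ℬ, we can Minkowski add a ball B_ε to 𝒜 such that 𝒜 + B_ε ⊂ ℬ, provided that this ball only extends in the
subspace orthogonal to 𝟙ℝ which is parallel to H_ξ and ε is sufficiently small. Let B_ε = {v ∈ ℝⁿ : ⟨𝟙,v⟩ = 0 and ‖v‖ ≤ ε} be such a
ball. … max_{v∈𝒜}⟨y,v⟩ + ε‖y‖_{ℝⁿ/𝟙ℝ} = max_{v∈𝒜}⟨y,v⟩ + max_{v∈B_ε}⟨y,v⟩ = max_{v∈𝒜+B_ε}⟨y,v⟩ ≤ max_{v∈ℬ}⟨y,v⟩ for all y ∈ ℝⁿ."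
eq. (def_residualab) (l.824) R_{a/b}; **proof of Theorem 3** (l.855–858): "We only need to prove that each sector integral in the
geometric sector decomposition of Theorem 19 with f(x) = R_{a/b}(x) … is finite. As all the denominator polynomials {b_j} are completely
non-vanishing, Corollary 9 implies that |R_{a/b}(x)| is bounded on ℙ^{n−1}_{>0}. Hence, each integral I_C[R_{a/b}] is finite."; §5
eq. (integral_trop) (l.887): "I^tr = ∫_{ℙ^{n−1}_{>0}} Π_i a_i^tr(x)^{Re ν_i}/Π_j b_j^tr(x)^{Re ρ_j} Ω" (the normalisation of μ^tr,
eq. (mu_probability)).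

TYPING. Ambient dimension written `n + 1` in the integral statements (variables `x_0, …, x_n : Fin (n+1)`, so the printed "ℬ is
(n−1)-dimensional in ℝⁿ" reads `Module.finrank ℝ (vectorSpan ℝ ℬ) = n` in `ℝ^{n+1}`), and `m` in the polytope lemmas. Real coefficients and
REAL exponents `ν_i, ρ_j ≥ 0` = the printed weights `Re ν_i, Re ρ_j ≥ 0` of the Minkowski sums (TODO(general form): complex `ν, ρ` and
ℂ-coefficients with `|a^ν| = |a|^{Re ν}` for the branch of §1.2 — same proofs on the modulus). NO new definition is introduced (D-0026
economy): the Newton polytope is written out as `convexHull ℝ` of the exponent vectors `ℓ ↦ (ℓ_k)_k ∈ ℝ^{n}` of `p.support` (local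
notation `NP⟦p⟧`, `pts⟦p⟧` in this file only), the weighted Minkowski sums `𝒜 = Σ_i ν_i • NP⟦a_i⟧`, `ℬ = Σ_j ρ_j • NP⟦b_j⟧` are
Mathlib's pointwise set operations, the support functions `max_{v∈𝒜}⟨y,v⟩` are the finite maxima `Σ_i ν_i · faceValue (a i) y` of the
companion files (Proposition 7: `trop_exp`) — the two agree on `𝒜` by `dotProduct_le_of_mem_minkowskiSum` /
`exists_mem_minkowskiSum_dotProduct_eq` —, "relint" is Mathlib's `intrinsicInterior ℝ`, R3 is the companion's `CompletelyNonVanishing (b j)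
{x | ∀ k, 0 < x k}`. The CONCLUSION "the integral is convergent" is typed as ABSOLUTE convergence of eq. (integral_euler_mellin): in the
chart `x_n = 1` with `x = e^y` (`Π_k dx_k/x_k = dy`), `y ↦ Π_i |a_i(e^{(y,0)})|^{ν_i}/Π_j |b_j(e^{(y,0)})|^{ρ_j}` is Lebesgue-integrable on
`ℝⁿ` (`integrable_of_R1_R2_R3`), equivalently `x ↦ (Π_i |a_i(x,1)|^{ν_i}/Π_j |b_j(x,1)|^{ρ_j}) Π_k x_k⁻¹` is integrable on `ℝⁿ_{>0}`
(`integrableOn_of_R1_R2_R3`; the change of variables is Mathlib's Jacobian theorem, `integrableOn_mul_prod_inv_iff_integrable_exp`).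
HYPOTHESES as printed, with two remarks: the numerators' homogeneity and eq. (homogeneous) serve in print only to place `𝒜` in the
hyperplane of `ℬ` (Remark 4), which R2 as typed (`𝒜 ⊆ intrinsicInterior ℝ ℬ ⊆ aff ℬ`) already forces — so only the DENOMINATORS'
homogeneity `(b j).IsHomogeneous (db j)` is a hypothesis (it gives `ℬ ⊂ H_ξ`, `sum_eq_of_mem_minkowskiSum`); and `a_i ≠ 0` is explicit
(a zero numerator has no Newton polytope in print). Lemma 15's quotient norm: the conclusion is typed in the coordinate form
`ε (y_k − y_{k'}) ≤ max_ℬ − max_𝒜` for all `k, k'` (`gap_of_ball`), i.e. `ε·osc(y)`, and in the printed shape `ε · inf_μ ‖y + μ𝟙‖ ≤ …`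
for the SUP norm of `ℝⁿ` (`mul_quotientNorm_le_gap_of_ball`; the print's Euclidean norm changes `ε` by a dimensional factor only).

PROOF ROUTE (disclosed deviation). Theorem 3's printed proof routes the final step through the geometric sector decomposition
(Theorem 19: a simplicial refinement of the common normal fan of `𝒜`, `ℬ`, Lemma 17's cone integrals), whose fan objects Mathlib lacks.
This file takes instead the DIRECT domination that the paper states right after eq. (atrbtr_exp) (l.666, "this exponent is falling
sufficiently fast for large y for the integral in eq. (integral) to be convergent"): with Lemma 15 and Corollary 9,
`|integrand(e^y)| = e^{−(max_ℬ−max_𝒜)(y)}·|R_{a/b}(e^y)| ≤ C·e^{−ε‖y‖_∞} ≤ C·Π_k e^{−(ε/(n+1))|y_k|}`, an integrable product — same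
hypotheses, same lemmas (Lemma 15, Proposition 7 / eq. (atrbtr_exp), Theorem 8 / Corollary 9), no fan. Lemma 15 itself is proved AS
PRINTED (the ball `B_ε ⊂ 𝟙^⊥` Minkowski-added to `𝒜` inside `ℬ`, then `max_𝒜 + ⟨y,u⟩ ≤ max_ℬ` for `u ∈ B_ε`), the existence of the
ball from R1 ∧ R2 being made uniform over `𝒜` through its finitely many generating points and the convexity of `ℬ`
(`ball_of_R1_R2`); the per-point statement is the definition of the intrinsic interior (`exists_add_mem_of_mem_intrinsicInterior`).

PROVED (0 named facts, D-0026; Mathlib + the companion files `TropicalApproximation` / `TropicalLowerBound` / `ConeIntegral` only):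
* support functions: `dotProduct_natCast_eq_pairing`, `dotProduct_le_faceValue_of_mem_newtonPolytope`,
  `exists_mem_newtonPolytope_dotProduct_eq` (max over `NP_p` = max over `supp p`, eq. (logPtr)), `dotProduct_le_of_mem_minkowskiSum`,
  `exists_mem_minkowskiSum_dotProduct_eq` (max over `Σ_i ν_i NP_{a_i}` = `Σ_i ν_i max_{NP_{a_i}}`), **`prod_trop_rpow_div_eq_exp`** =
  eq. (atrbtr_exp); `sum_eq_of_mem_minkowskiSum` (Remark 4: `ℬ ⊂ {⟨𝟙,v⟩ = Σ_j ρ_j deg b_j}`), `minkowskiSum_eq_convexHull`,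
  `finite_minkowskiSum_support`;
* **Lemma 15**: `gap_of_ball` (ball ⇒ `δ(y_k − y_{k'}) ≤ max_ℬ − max_𝒜`), `mul_quotientNorm_le_gap_of_ball` (printed shape),
  `exists_add_mem_of_mem_intrinsicInterior`, `mem_vectorSpan_of_finrank_eq` (R1 ⇒ the direction of `aff ℬ` is all of `𝟙^⊥`),
  **`ball_of_R1_R2`** (R1 ∧ R2 ⇒ `∃ δ > 0, 𝒜 + B_δ ⊂ ℬ`);
* **Theorem 3**: `eval_ne_zero_of_completelyNonVanishing` (R3 ⇒ no zero on the orthant), `integrable_of_gap` (gap ∧ R3 ⇒ integrable;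
  the analytic core), **`integrable_of_R1_R2_R3`** (R1 ∧ R2 ∧ R3 ⇒ integrable, log chart), **`integrableOn_of_R1_R2_R3`** (the same in
  the coordinates of eq. (integral_euler_mellin): `∫_{ℝⁿ_{>0}} (…)|_{x_n=1} Π dx_k/x_k` converges absolutely),
  `integrableOn_mul_prod_inv_iff_integrable_exp` (the logarithmic chart), plumbing `gap_snoc_bounds`, `exp_neg_le_prod_exp`,
  `integrable_prod_exp_neg_mul_abs`, `continuous_expSnoc`, `continuous_faceValue`, `snoc_exp_one`;
* **`I^tr < ∞`**: `integrable_tropical_of_gap` (gap ⇒ the integrand of eq. (integral_trop) is integrable; NO R3, only `a_i, b_j ≠ 0`)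
  and `integrable_tropical_of_R1_R2`;
* **generalized permutahedra (§6, with the companions `GeneralizedPermutahedronVertex.lean` / `GeneralizedPermutahedronInterior.lean`)**:
  `sum_faceValue_eq_dotProduct_ftVertex` (Lemma 26 ⇒ for `𝒜 = 𝒢_z` the support function on the Weyl chamber `C_σ` is `⟨y, w^{(σ,z)}⟩`),
  `prod_trop_rpow_div_eq_exp_neg_dotProduct_of_gp` (Lemma 16 / proof of Theorem 27: on `C_σ` the tropical part is the ONE monomial
  `e^{−⟨y, w^{(σ,z_ℬ)} − w^{(σ,z_𝒜)}⟩}`), `sum_chainSet_ftVertex_sub` (its chain-set exponents `−(z_𝒜(A^σ_k) − z_ℬ(A^σ_k)) = −r(A^σ_k)`,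
  eq. (40)), **`integrable_of_gp`** (Theorem 27's hypotheses — `𝒜 = 𝒢_{z_𝒜}`, `ℬ = 𝒢_{z_ℬ}` as sets, `r(A) = z_𝒜(A) − z_ℬ(A) > 0` on the
  non-empty proper subsets, `z_𝒜([n]) = z_ℬ([n])` — together with R1 and R3 give Theorem 3's conclusion; R2 is Corollary 24,
  `gpPolytope_subset_intrinsicInterior`).
* **§5 eq. (mu_probability) — the tropical probability measure and `I = I^tr ∫ R_{a/b} μ^tr`**: for an abstract weight,
  `isProbabilityMeasure_withDensity_div_integral` (`μ^tr := (T/I^tr)·vol` has mass 1) and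
  `integral_mul_eq_integral_mul_integral_withDensity` (`∫ T·R = I^tr · ∫ R dμ^tr`); concretely in the chart `x_n = 1`, `x = e^y`,
  under the gap of Lemma 15: `integral_tropical_pos_of_gap` (`0 < I^tr`, l.897), **`isProbabilityMeasure_tropicalMeasure_of_gap`**
  (`μ^tr` with Lebesgue density `T/I^tr`, `T = Π_i a_i^tr^{ν_i}/Π_j b_j^tr^{ρ_j}`, IS a probability measure on `ℝⁿ`) and
  **`integral_eq_integral_tropical_mul_integral_residual`** (the convergent integral of Theorem 3 equals `I^tr · ∫ |R_{a/b}| dμ^tr` —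
  the expectation Algorithm 2 estimates; the companion `TropicalSamplingEstimator.lean` treats `μ^tr`, `R` abstractly from there).
NOT typed: Theorem 19 / Lemma 16 / Lemma 17's fan statements for a GENERAL fan (the sector SUM; `ConeIntegral.lean` has the single-cone
integral, `HeppSectorDecomposition.lean` the braid-fan partition) and Theorem 27's sector VALUE `I^tr_{C_σ} = 1/Π_k r(A^σ_k)` (eq. (40):
the cone integral of `ConeIntegral.lean` / `HeppSectorCoordinates.lean` is not assembled with the monomial identification here); the converse direction (Nilsson–Passare: the conditions are also necessary — not
claimed in [Borinsky2020]); complex exponents / coefficients; the value of `I` as a projective integral independent of the chart (only the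
chart `x_n = 1` of eq. (integral_euler_mellin) is typed); Proposition 18 / Algorithm 1 (the companion `TropicalSamplingEstimator.lean`
types the estimator statements); that Algorithms 3 / 4 SAMPLE from `μ^tr` (Proposition 31: the law of their output is the measure
typed here) — the remaining DERIVED step between this file and `TropicalSamplingEstimator.lean`. (Filed by the pub-qed TROPICAL literature seat `pub-qed-trop-lit` gen 25; `tropical/lit/SOURCES.md` A24.)
-/

noncomputable section

open MvPolynomial Finset Real MeasureTheory

open scoped Pointwise

namespace Literature.MathematicalPhysics.QuantumFieldTheory.Borinsky2020

/-- The exponent vectors `ℓ ∈ supp(p) ⊂ ℤⁿ` of `p` "interpreted as vectors in ℝⁿ" (tropical.tex l.297–299). Local notation only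
(no new definition is introduced). -/
local notation3 (prettyPrint := false) "pts⟦" p "⟧" =>
  ((fun d : (_ →₀ ℕ) => fun k => ((d k : ℕ) : ℝ)) '' {d | d ∈ MvPolynomial.support p})

/-- The Newton polytope `NP_p = conv(supp p)` ("The Newton polytope of p is the convex hull of the elements in supp(p) interpreted as
vectors in ℝⁿ", tropical.tex l.297–299). Local notation only (no new definition is introduced). -/
local notation3 (prettyPrint := false) "NP⟦" p "⟧" => convexHull ℝ pts⟦p⟧

variable {m : ℕ}

/-! ### Support functions of Newton polytopes and of their weighted Minkowski sums (§2, Proposition 7, eq. (atrbtr_exp)) -/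

/-- `⟨y, ℓ⟩` computed in `ℝⁿ` is the typed `pairing y ℓ` of the companion files. [cite: Borinsky2020, §2 (tropical.tex l.291, l.297)] -/
theorem dotProduct_natCast_eq_pairing (y : Fin m → ℝ) (d : Fin m →₀ ℕ) :
    y ⬝ᵥ (fun k => ((d k : ℕ) : ℝ)) = pairing y d := by
  unfold pairing dotProduct
  symm
  refine Finset.sum_subset (Finset.subset_univ _) fun k _ hk => ?_
  rw [Finsupp.notMem_support_iff.mp hk]
  simp

/-- The support function of the Newton polytope is the face value: `⟨y, v⟩ ≤ max_{ℓ∈supp p} ⟨y,ℓ⟩` for every `v ∈ NP_p`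
("max_{ℓ∈supp(p)} ⟨y,ℓ⟩ = max_{v∈NP_p} ⟨y,v⟩", eq. (logPtr)). [cite: Borinsky2020, eq. (logPtr) (tropical.tex l.415–419); Proposition 7] -/
theorem dotProduct_le_faceValue_of_mem_newtonPolytope {p : MvPolynomial (Fin m) ℝ} (y : Fin m → ℝ)
    {v : Fin m → ℝ} (hv : v ∈ NP⟦p⟧) : y ⬝ᵥ v ≤ faceValue p y := by
  have hlin : IsLinearMap ℝ (fun v : Fin m → ℝ => y ⬝ᵥ v) :=
    ⟨fun v w => dotProduct_add y v w, fun c v => dotProduct_smul c y v⟩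
  refine convexHull_min ?_ (convex_halfSpace_le hlin (faceValue p y)) hv
  rintro _ ⟨d, hd, rfl⟩
  show y ⬝ᵥ (fun k => ((d k : ℕ) : ℝ)) ≤ faceValue p y
  rw [dotProduct_natCast_eq_pairing]
  exact pairing_le_faceValue (Finset.mem_coe.mp hd) y

/-- The face value is attained on the Newton polytope (at a vertex `ℓ ∈ supp p`).
[cite: Borinsky2020, eq. (logPtr) (tropical.tex l.415–419); §2 (l.291)] -/
theorem exists_mem_newtonPolytope_dotProduct_eq {p : MvPolynomial (Fin m) ℝ} (hp : p ≠ 0) (y : Fin m → ℝ) :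
    ∃ v ∈ NP⟦p⟧, y ⬝ᵥ v = faceValue p y := by
  obtain ⟨d, hd, h⟩ := exists_pairing_eq_faceValue hp y
  exact ⟨_, subset_convexHull ℝ _ (Set.mem_image_of_mem _ (Finset.mem_coe.mpr hd)),
    by rw [dotProduct_natCast_eq_pairing, h]⟩

/-- Support function of the weighted Minkowski sum `𝒜 = Σ_i ν_i NP_{a_i}` (`ν_i ≥ 0`): `⟨y, v⟩ ≤ Σ_i ν_i max_{ℓ∈supp a_i}⟨y,ℓ⟩` for
`v ∈ 𝒜` ("Σ_i Re ν_i max_{v∈NP_{a_i}}⟨y,v⟩ = max_{v∈𝒜}⟨y,v⟩", eq. (atrbtr_exp)).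
[cite: Borinsky2020, eq. (atrbtr_exp) (tropical.tex l.665); Theorem 3 (definition of 𝒜, ℬ, l.318–320)] -/
theorem dotProduct_le_of_mem_minkowskiSum {ι : Type*} [Fintype ι] (a : ι → MvPolynomial (Fin m) ℝ) {ν : ι → ℝ}
    (hν : ∀ i, 0 ≤ ν i) (y : Fin m → ℝ) {v : Fin m → ℝ} (hv : v ∈ ∑ i, ν i • NP⟦a i⟧) :
    y ⬝ᵥ v ≤ ∑ i, ν i * faceValue (a i) y := by
  obtain ⟨g, hg, rfl⟩ := (Set.mem_fintype_sum _ _).mp hv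
  rw [dotProduct_sum]
  refine Finset.sum_le_sum fun i _ => ?_
  obtain ⟨w, hw, hgw⟩ := Set.mem_smul_set.mp (hg i)
  rw [← hgw, dotProduct_smul, smul_eq_mul]
  exact mul_le_mul_of_nonneg_left (dotProduct_le_faceValue_of_mem_newtonPolytope y hw) (hν i)

/-- The support function of `𝒜 = Σ_i ν_i NP_{a_i}` is attained: some `v ∈ 𝒜` has `⟨y, v⟩ = Σ_i ν_i max_{ℓ∈supp a_i}⟨y,ℓ⟩`
(the point `w_𝒜` of Lemma 16 / Theorem 19). [cite: Borinsky2020, eq. (atrbtr_exp) (tropical.tex l.665); Lemma 16 (l.702–710)] -/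
theorem exists_mem_minkowskiSum_dotProduct_eq {ι : Type*} [Fintype ι] (a : ι → MvPolynomial (Fin m) ℝ)
    (ha : ∀ i, a i ≠ 0) (ν : ι → ℝ) (y : Fin m → ℝ) :
    ∃ v ∈ ∑ i, ν i • NP⟦a i⟧, y ⬝ᵥ v = ∑ i, ν i * faceValue (a i) y := by
  choose w hw hyw using fun i => exists_mem_newtonPolytope_dotProduct_eq (ha i) y
  refine ⟨∑ i, ν i • w i,
    (Set.mem_fintype_sum _ _).mpr ⟨fun i => ν i • w i, fun i => Set.smul_mem_smul_set (hw i), rfl⟩, ?_⟩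
  rw [dotProduct_sum]
  simp only [dotProduct_smul, smul_eq_mul, hyw]

/-- **eq. (atrbtr_exp)** — the tropical part of the integrand in logarithmic coordinates `x = e^y`:
`Π_i a_i^tr(e^y)^{ν_i} / Π_j b_j^tr(e^y)^{ρ_j} = exp(Σ_i ν_i max_{NP_{a_i}}⟨y,·⟩ − Σ_j ρ_j max_{NP_{b_j}}⟨y,·⟩) = exp(max_𝒜⟨y,·⟩ − max_ℬ⟨y,·⟩)`
(Proposition 7 per factor). [cite: Borinsky2020, eq. (atrbtr_exp) (tropical.tex l.663–666); Proposition 7] -/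
theorem prod_trop_rpow_div_eq_exp {ι κ : Type*} [Fintype ι] [Fintype κ]
    (a : ι → MvPolynomial (Fin m) ℝ) (b : κ → MvPolynomial (Fin m) ℝ) (ν : ι → ℝ) (ρ : κ → ℝ)
    (ha : ∀ i, a i ≠ 0) (hb : ∀ j, b j ≠ 0) (y : Fin m → ℝ) :
    (∏ i, trop (a i) (fun k => exp (y k)) ^ ν i) / ∏ j, trop (b j) (fun k => exp (y k)) ^ ρ j =
      exp ((∑ i, ν i * faceValue (a i) y) - ∑ j, ρ j * faceValue (b j) y) := by
  simp only [trop_exp (ha _), trop_exp (hb _), ← Real.exp_mul, ← Real.exp_sum, ← Real.exp_sub]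
  congr 1
  simp only [mul_comm (faceValue _ y)]

/-! ### Lemma 15: from the ball `𝒜 + B_ε ⊂ ℬ` to the gap of the support functions -/

/-- **Lemma 15, the printed mechanism**: if a ball of radius `δ` of the hyperplane direction `{u : ⟨𝟙,u⟩ = 0}` can be Minkowski-added
to `𝒜` inside `ℬ` ("we can Minkowski add a ball B_ε to 𝒜 such that 𝒜 + B_ε ⊂ ℬ … Let B_ε = {v ∈ ℝⁿ : ⟨𝟙,v⟩ = 0 and ‖v‖ ≤ ε}"), then
`max_ℬ⟨y,·⟩ − max_𝒜⟨y,·⟩ ≥ δ (y_k − y_{k'})` for all `y` and all coordinates `k, k'` — i.e. `≥ δ·(max_k y_k − min_k y_k)`, which for the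
sup norm on `ℝⁿ` is `2δ‖y‖_{ℝⁿ/𝟙ℝ}` with the printed quotient norm `‖y‖_{ℝⁿ/𝟙ℝ} = inf_μ ‖y + μ𝟙‖` (the paper uses the Euclidean norm;
the two statements differ by a dimensional constant absorbed in `ε`). Proof as printed: `max_𝒜⟨y,·⟩ + ⟨y,u⟩ ≤ max_ℬ⟨y,·⟩` for
`u = δ(e_k − e_{k'}) ∈ B_δ`. [cite: Borinsky2020, Lemma 15 and its proof (tropical.tex l.669–688)] -/
theorem gap_of_ball {ι κ : Type*} [Fintype ι] [Fintype κ]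
    (a : ι → MvPolynomial (Fin m) ℝ) (b : κ → MvPolynomial (Fin m) ℝ) (ν : ι → ℝ) (ρ : κ → ℝ)
    (ha : ∀ i, a i ≠ 0) (hρ : ∀ j, 0 ≤ ρ j) {δ : ℝ} (hδ : 0 ≤ δ)
    (hball : ∀ v ∈ ∑ i, ν i • NP⟦a i⟧, ∀ u : Fin m → ℝ, ∑ k, u k = 0 → ‖u‖ ≤ δ → v + u ∈ ∑ j, ρ j • NP⟦b j⟧)
    (y : Fin m → ℝ) (k k' : Fin m) :
    δ * (y k - y k') ≤ (∑ j, ρ j * faceValue (b j) y) - ∑ i, ν i * faceValue (a i) y := by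
  obtain ⟨v, hv, hyv⟩ := exists_mem_minkowskiSum_dotProduct_eq a ha ν y
  set u : Fin m → ℝ := δ • (Pi.single k 1 - Pi.single k' 1) with hu
  have hsum : ∑ l, u l = 0 := by
    simp only [hu, Pi.smul_apply, Pi.sub_apply, smul_eq_mul, ← Finset.mul_sum, Finset.sum_sub_distrib,
      Finset.sum_pi_single', Finset.mem_univ, if_true, sub_self, mul_zero]
  have hnorm : ‖u‖ ≤ δ := by
    refine (pi_norm_le_iff_of_nonneg hδ).2 fun l => ?_
    simp only [hu, Pi.smul_apply, Pi.sub_apply, smul_eq_mul, Pi.single_apply, Real.norm_eq_abs]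
    split_ifs <;> simp [abs_of_nonneg hδ, hδ]
  have h1 := dotProduct_le_of_mem_minkowskiSum b hρ y (hball v hv u hsum hnorm)
  have hyu : y ⬝ᵥ u = δ * (y k - y k') := by
    simp only [hu, dotProduct_smul, smul_eq_mul, dotProduct_sub, dotProduct_single, mul_one]
  rw [dotProduct_add, hyv, hyu] at h1
  linarith

/-- **Lemma 15 in its printed shape** — the quotient norm `‖y‖_{ℝⁿ/𝟙ℝ} = inf_{μ∈ℝ} ‖y + μ𝟙‖` (here for the sup norm of `ℝⁿ`;
the print uses the Euclidean one): under the ball `𝒜 + B_δ ⊂ ℬ`, `δ‖y‖_{ℝⁿ/𝟙ℝ} ≤ max_ℬ⟨y,·⟩ − max_𝒜⟨y,·⟩` for every `y ∈ ℝⁿ`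
("there is a constant ε > 0 such that max_{v∈ℬ}⟨y,v⟩ − max_{v∈𝒜}⟨y,v⟩ ≥ ε‖y‖_{ℝⁿ/𝟙ℝ} for all y ∈ ℝⁿ/𝟙ℝ, where
‖y‖_{ℝⁿ/𝟙ℝ} = inf_{μ∈ℝ} ‖y + μ𝟙‖"). From `gap_of_ball` at a maximal and a minimal coordinate. Ambient dimension written `m + 1 ≥ 1`.
[cite: Borinsky2020, Lemma 15 (tropical.tex l.669–676) = AIHPD 10 Lemma 4.1 p. 652] -/
theorem mul_quotientNorm_le_gap_of_ball {ι κ : Type*} [Fintype ι] [Fintype κ]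
    (a : ι → MvPolynomial (Fin (m + 1)) ℝ) (b : κ → MvPolynomial (Fin (m + 1)) ℝ) (ν : ι → ℝ) (ρ : κ → ℝ)
    (ha : ∀ i, a i ≠ 0) (hρ : ∀ j, 0 ≤ ρ j) {δ : ℝ} (hδ : 0 ≤ δ)
    (hball : ∀ v ∈ ∑ i, ν i • NP⟦a i⟧, ∀ u : Fin (m + 1) → ℝ, ∑ k, u k = 0 → ‖u‖ ≤ δ →
      v + u ∈ ∑ j, ρ j • NP⟦b j⟧)
    (y : Fin (m + 1) → ℝ) :
    δ * (⨅ μ : ℝ, ‖y + μ • (1 : Fin (m + 1) → ℝ)‖) ≤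
      (∑ j, ρ j * faceValue (b j) y) - ∑ i, ν i * faceValue (a i) y := by
  obtain ⟨k₀, -, hk₀⟩ := Finset.exists_max_image Finset.univ y Finset.univ_nonempty
  obtain ⟨k₁, -, hk₁⟩ := Finset.exists_min_image Finset.univ y Finset.univ_nonempty
  have hgap := gap_of_ball a b ν ρ ha hρ hδ hball y k₀ k₁
  have h01 : y k₁ ≤ y k₀ := hk₁ k₀ (Finset.mem_univ _)
  set μ₀ : ℝ := -(y k₀ + y k₁) / 2 with hμ₀
  have hbound : ‖y + μ₀ • (1 : Fin (m + 1) → ℝ)‖ ≤ y k₀ - y k₁ := by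
    refine (pi_norm_le_iff_of_nonneg (by linarith)).2 fun k => ?_
    simp only [Pi.add_apply, Pi.smul_apply, Pi.one_apply, smul_eq_mul, mul_one, Real.norm_eq_abs]
    rw [abs_le]
    constructor <;> linarith [hk₀ k (Finset.mem_univ _), hk₁ k (Finset.mem_univ _)]
  have hinf : (⨅ μ : ℝ, ‖y + μ • (1 : Fin (m + 1) → ℝ)‖) ≤ y k₀ - y k₁ :=
    (ciInf_le ⟨0, Set.forall_mem_range.2 fun μ => norm_nonneg _⟩ μ₀).trans hbound
  calc δ * (⨅ μ : ℝ, ‖y + μ • (1 : Fin (m + 1) → ℝ)‖) ≤ δ * (y k₀ - y k₁) := by gcongr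
    _ ≤ _ := hgap

/-! ### R1 ∧ R2 ⇒ the ball (first paragraph of the proof of Lemma 15) -/

/-- A point of the intrinsic (relative) interior of `s` can be moved by every sufficiently short vector of the direction of the affine
hull of `s` without leaving `s` ("we can Minkowski add a ball B_ε … provided that this ball only extends in the subspace … parallel to
H_ξ and ε is sufficiently small"). [cite: Borinsky2020, proof of Lemma 15 (tropical.tex l.680–682)] -/
theorem exists_add_mem_of_mem_intrinsicInterior {E : Type*} [NormedAddCommGroup E] [NormedSpace ℝ E] {s : Set E} {x : E}
    (hx : x ∈ intrinsicInterior ℝ s) : ∃ δ : ℝ, 0 < δ ∧ ∀ u ∈ vectorSpan ℝ s, ‖u‖ ≤ δ → x + u ∈ s := by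
  obtain ⟨z, hz, rfl⟩ := mem_intrinsicInterior.1 hx
  obtain ⟨r, hr, hball⟩ := Metric.mem_nhds_iff.1 (mem_interior_iff_mem_nhds.1 hz)
  refine ⟨r / 2, by positivity, fun u hu hur => ?_⟩
  have hmem : (z : E) + u ∈ affineSpan ℝ s := by
    have h := AffineSubspace.vadd_mem_of_mem_direction (s := affineSpan ℝ s)
      (by rw [direction_affineSpan]; exact hu) z.2
    simpa [vadd_eq_add, add_comm] using h
  have hlt : (⟨(z : E) + u, hmem⟩ : affineSpan ℝ s) ∈ Metric.ball z r := by
    rw [Metric.mem_ball, Subtype.dist_eq, dist_eq_norm]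
    simp only [add_sub_cancel_left]
    linarith
  exact hball hlt

/-- For HOMOGENEOUS `b_j` of degrees `d_j`, the polytope `ℬ = Σ_j ρ_j NP_{b_j}` lies in the hyperplane `{v : ⟨𝟙,v⟩ = ξ}`,
`ξ = Σ_j ρ_j d_j` (Remark 4: "𝒜 and ℬ both lie in the same hyperplane … ⟨𝟙,v⟩ = ξ, where ξ = Σ_i Re ν_i deg a_i = Σ_j Re ρ_j deg b_j").
[cite: Borinsky2020, Remark 4 (tropical.tex l.333–337); §2 (l.299: NP_p ⊂ {⟨𝟙,v⟩ = deg p})] -/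
theorem sum_eq_of_mem_minkowskiSum {κ : Type*} [Fintype κ] (b : κ → MvPolynomial (Fin m) ℝ) (ρ : κ → ℝ)
    {db : κ → ℕ} (hhb : ∀ j, (b j).IsHomogeneous (db j)) {v : Fin m → ℝ} (hv : v ∈ ∑ j, ρ j • NP⟦b j⟧) :
    ∑ k, v k = ∑ j, ρ j * db j := by
  obtain ⟨g, hg, rfl⟩ := (Set.mem_fintype_sum _ _).mp hv
  simp only [Finset.sum_apply]
  rw [Finset.sum_comm]
  refine Finset.sum_congr rfl fun j _ => ?_
  obtain ⟨w, hw, hgw⟩ := Set.mem_smul_set.mp (hg j)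
  -- the Newton polytope of a homogeneous polynomial lies in `{⟨𝟙,v⟩ = deg}`
  have hplane : ∑ k, w k = db j := by
    have hlin : IsLinearMap ℝ (fun v : Fin m → ℝ => ∑ k, v k) :=
      ⟨fun v w => by simp [Finset.sum_add_distrib], fun c v => by simp [Finset.mul_sum]⟩
    have hconv : Convex ℝ {v : Fin m → ℝ | ∑ k, v k = (db j : ℝ)} := convex_hyperplane hlin _
    refine (convexHull_min ?_ hconv hw :)
    rintro _ ⟨d, hd, rfl⟩
    show ∑ k, ((d k : ℕ) : ℝ) = (db j : ℝ)
    have h := (hhb j).degree_eq_sum_deg_support (Finset.mem_coe.mp hd)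
    rw [← Nat.cast_sum, ← Finset.sum_subset (Finset.subset_univ d.support)
      (fun k _ hk => Finsupp.notMem_support_iff.mp hk), ← h]
  rw [← hgw]
  simp only [Pi.smul_apply, smul_eq_mul, ← Finset.mul_sum, hplane]

/-- `Σ_i ν_i NP_{a_i} = conv(Σ_i ν_i supp(a_i))`: the weighted Minkowski sum of the Newton polytopes is the convex hull of the FINITE set
of weighted sums of exponent vectors (Minkowski sums and dilations commute with convex hulls). Plumbing about the printed objects "the
weighted Minkowski sum of two polytopes λ𝒫 + μ𝒬" and "The Newton polytope of p is the convex hull of the elements in supp(p)".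
[cite: Borinsky2020, §2 (tropical.tex l.293 and l.297–299)] -/
theorem minkowskiSum_eq_convexHull {ι : Type*} [Fintype ι] (a : ι → MvPolynomial (Fin m) ℝ) (ν : ι → ℝ) :
    (∑ i, ν i • NP⟦a i⟧) = convexHull ℝ
      (∑ i, ν i • pts⟦a i⟧) := by
  rw [convexHull_sum]
  simp only [convexHull_smul]

/-- The generating set `Σ_i ν_i supp(a_i)` of `Σ_i ν_i NP_{a_i}` is finite ("the support of p, is the set of all multi-indices … such
that c_ℓ ≠ 0"). Plumbing. [cite: Borinsky2020, §2 (tropical.tex l.293–299)] -/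
theorem finite_minkowskiSum_support {ι : Type*} [Fintype ι] (a : ι → MvPolynomial (Fin m) ℝ) (ν : ι → ℝ) :
    (∑ i, ν i • pts⟦a i⟧).Finite := by
  refine Finset.sum_induction _ (fun s : Set (Fin m → ℝ) => s.Finite) (fun s t hs ht => hs.add ht)
    Set.finite_zero (fun i _ => ?_)
  exact ((a i).support.finite_toSet.image _).smul_set

/-- **R1**, read on the direction: if `ℬ ⊂ {⟨𝟙,v⟩ = ξ}` is `(n−1)`-dimensional in `ℝⁿ` (here: the direction `vectorSpan ℝ ℬ` of its
affine hull has dimension `n − 1`; ambient dimension written `m = n`), then that direction is the whole hyperplane direction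
`{u : ⟨𝟙,u⟩ = 0}` ("As ℬ is full-dimensional in H_ξ … ℬ^⊥ = 𝟙ℝ"). [cite: Borinsky2020, Theorem 3 R1 (tropical.tex l.323–324); Remark 4; §4 (l.697)] -/
theorem mem_vectorSpan_of_finrank_eq {B : Set (Fin (m + 1) → ℝ)} {ξ : ℝ} (hB : ∀ v ∈ B, ∑ k, v k = ξ)
    (hR1 : Module.finrank ℝ (vectorSpan ℝ B) = m) {u : Fin (m + 1) → ℝ} (hu : ∑ k, u k = 0) :
    u ∈ vectorSpan ℝ B := by
  -- the hyperplane direction as the kernel of the coordinate-sum functional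
  let φ : (Fin (m + 1) → ℝ) →ₗ[ℝ] ℝ := ∑ k, LinearMap.proj k
  have hφ : ∀ v, φ v = ∑ k, v k := fun v => by simp [φ]
  have hle : vectorSpan ℝ B ≤ LinearMap.ker φ := by
    rw [vectorSpan_def]
    refine Submodule.span_le.2 ?_
    rintro _ ⟨v, hv, w, hw, rfl⟩
    simp only [SetLike.mem_coe, LinearMap.mem_ker, hφ, vsub_eq_sub, Pi.sub_apply, Finset.sum_sub_distrib,
      hB v hv, hB w hw, sub_self]
  have hsurj : Function.Surjective φ := fun c =>
    ⟨Pi.single 0 c, by rw [hφ]; simp [Finset.sum_pi_single']⟩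
  have hker : Module.finrank ℝ (LinearMap.ker φ) = m := by
    have h := LinearMap.finrank_range_add_finrank_ker φ
    rw [LinearMap.range_eq_top.2 hsurj, finrank_top, Module.finrank_self, Module.finrank_fin_fun] at h
    omega
  have heq : vectorSpan ℝ B = LinearMap.ker φ :=
    Submodule.eq_of_le_of_finrank_eq hle (by rw [hR1, hker])
  rw [heq, LinearMap.mem_ker, hφ, hu]

/-- **R1 ∧ R2 ⇒ the ball of Lemma 15**: if the denominators `b_j` are homogeneous, `ℬ = Σ_j ρ_j NP_{b_j}` is `(n−1)`-dimensional
(R1, on the direction of its affine hull) and `𝒜 = Σ_i ν_i NP_{a_i} ⊂ relint ℬ` (R2, Mathlib's `intrinsicInterior`), then there is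
`δ > 0` with `𝒜 + B_δ ⊂ ℬ`, `B_δ = {u : ⟨𝟙,u⟩ = 0, ‖u‖ ≤ δ}` ("As ℬ is full-dimensional in H_ξ and 𝒜 ⊂ relint ℬ, we can Minkowski
add a ball B_ε to 𝒜 such that 𝒜 + B_ε ⊂ ℬ"). Uniformity in the point of `𝒜`: `𝒜` is the convex hull of finitely many points, each of
which admits a radius, and `ℬ` is convex. [cite: Borinsky2020, proof of Lemma 15 (tropical.tex l.678–682); Theorem 3 R1, R2 (l.323–326)] -/
theorem ball_of_R1_R2 {ι κ : Type*} [Fintype ι] [Fintype κ]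
    (a : ι → MvPolynomial (Fin (m + 1)) ℝ) (b : κ → MvPolynomial (Fin (m + 1)) ℝ) (ν : ι → ℝ) (ρ : κ → ℝ)
    (ha : ∀ i, a i ≠ 0) {db : κ → ℕ} (hhb : ∀ j, (b j).IsHomogeneous (db j))
    (hR1 : Module.finrank ℝ (vectorSpan ℝ (∑ j, ρ j • NP⟦b j⟧)) = m)
    (hR2 : (∑ i, ν i • NP⟦a i⟧) ⊆ intrinsicInterior ℝ (∑ j, ρ j • NP⟦b j⟧)) :
    ∃ δ : ℝ, 0 < δ ∧ ∀ v ∈ ∑ i, ν i • NP⟦a i⟧, ∀ u : Fin (m + 1) → ℝ, ∑ k, u k = 0 → ‖u‖ ≤ δ →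
      v + u ∈ ∑ j, ρ j • NP⟦b j⟧ := by
  classical
  set A := ∑ i, ν i • NP⟦a i⟧ with hA
  set B := ∑ j, ρ j • NP⟦b j⟧ with hB
  set G := ∑ i, ν i • pts⟦a i⟧ with hG
  have hAG : A = convexHull ℝ G := minkowskiSum_eq_convexHull a ν
  have hGfin : G.Finite := finite_minkowskiSum_support a ν
  have hBconv : Convex ℝ B := by
    rw [hB, minkowskiSum_eq_convexHull b ρ]
    exact convex_convexHull ℝ _
  -- every `u` of the hyperplane direction lies in the direction of `aff ℬ` (R1)
  have hdir : ∀ u : Fin (m + 1) → ℝ, ∑ k, u k = 0 → u ∈ vectorSpan ℝ B :=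
    fun u hu => mem_vectorSpan_of_finrank_eq (fun v hv => sum_eq_of_mem_minkowskiSum b ρ hhb hv) hR1 hu
  -- a radius for every generator (R2)
  have hrad : ∀ g ∈ G, ∃ δ : ℝ, 0 < δ ∧ ∀ u ∈ vectorSpan ℝ B, ‖u‖ ≤ δ → g + u ∈ B := fun g hg =>
    exists_add_mem_of_mem_intrinsicInterior (hR2 (hAG ▸ subset_convexHull ℝ G hg))
  choose! δ hδpos hδ using hrad
  -- `G` is non-empty
  have hGne : hGfin.toFinset.Nonempty := by
    rw [Set.Finite.toFinset_nonempty]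
    have hpt : ∀ i, ∃ g, g ∈ ν i • pts⟦a i⟧ :=
      fun i => by
        obtain ⟨d, hd⟩ := support_nonempty.mpr (ha i)
        exact ⟨_, Set.smul_mem_smul_set (Set.mem_image_of_mem _ (Finset.mem_coe.mpr hd))⟩
    choose g hg using hpt
    exact ⟨∑ i, g i, (Set.mem_fintype_sum _ _).mpr ⟨g, hg, rfl⟩⟩
  refine ⟨hGfin.toFinset.inf' hGne δ, (Finset.lt_inf'_iff _).2 fun g hg => hδpos g (hGfin.mem_toFinset.mp hg),
    fun v hv u hu hnorm => ?_⟩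
  rw [hAG] at hv
  obtain ⟨T, _, w, z, hw0, hw1, hz, rfl⟩ := mem_convexHull_iff_exists_fintype.1 hv
  have hzu : ∀ t, z t + u ∈ B := fun t =>
    hδ (z t) (hz t) u (hdir u hu) (hnorm.trans (Finset.inf'_le _ (hGfin.mem_toFinset.mpr (hz t))))
  have heq : (∑ t, w t • z t) + u = ∑ t, w t • (z t + u) := by
    simp only [smul_add, Finset.sum_add_distrib, ← Finset.sum_smul, hw1, one_smul]
  rw [heq]
  exact hBconv.sum_mem (fun t _ => hw0 t) hw1 fun t _ => hzu t


/-! ### Theorem 3: the integral converges -/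

/-- R3 forbids zeros of the denominators on the open orthant: the truncation to the face exposed by `y = 0` (the whole Newton
polytope) is `p` itself. [cite: Borinsky2020, Definition 2 (tropical.tex l.309–311); Theorem 3 R3 (l.327–328)] -/
theorem eval_ne_zero_of_completelyNonVanishing {σ : Type*} {p : MvPolynomial σ ℝ} {X : Set (σ → ℝ)}
    (h : CompletelyNonVanishing p X) {x : σ → ℝ} (hx : x ∈ X) : eval x p ≠ 0 := by
  classical
  have hfv : faceValue p (0 : σ → ℝ) = 0 := by
    unfold faceValue
    split_ifs with hne
    · have h0 : pairing (0 : σ → ℝ) = fun _ => (0 : ℝ) := funext fun d => by simp [pairing]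
      rw [h0, Finset.sup'_const]
    · rfl
  have htr : trunc p 0 = p := by
    unfold trunc
    rw [Finset.filter_true_of_mem (fun d _ => by rw [hfv]; simp [pairing])]
    exact p.support_sum_monomial_coeff
  have h0 := h 0 x hx
  rwa [htr] at h0

/-- `∫_ℝ e^{−c|t|} dt < ∞` for `c > 0`. [folklore] -/
private theorem integrable_exp_neg_mul_abs_aux {c : ℝ} (hc : 0 < c) :
    Integrable fun t : ℝ => exp (-c * |t|) := by
  have h1 : IntegrableOn (fun t : ℝ => exp (-c * |t|)) (Set.Ioi 0) := by
    refine (integrableOn_exp_mul_Ioi (by linarith : -c < 0) 0).congr_fun (fun t ht => ?_) measurableSet_Ioi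
    rw [abs_of_pos (Set.mem_Ioi.mp ht)]
  have h2 : IntegrableOn (fun t : ℝ => exp (-c * |t|)) (Set.Iic 0) := by
    refine (integrableOn_exp_mul_Iic hc 0).congr_fun (fun t ht => ?_) measurableSet_Iic
    rw [abs_of_nonpos (Set.mem_Iic.mp ht)]
    ring_nf
  have h := h2.union h1
  rwa [Set.Iic_union_Ioi, integrableOn_univ] at h

/-- `Π_k ∫ e^{−c|y_k|} dy_k < ∞`: the dominating function of the convergence proof is integrable on `ℝⁿ`. [folklore] -/
private theorem integrable_prod_exp_neg_mul_abs {n : ℕ} {c : ℝ} (hc : 0 < c) :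
    Integrable (fun y : Fin n → ℝ => ∏ k, exp (-c * |y k|)) :=
  Integrable.fintype_prod (μ := fun _ : Fin n => (volume : Measure ℝ)) fun _ => integrable_exp_neg_mul_abs_aux hc

/-- From the gap on all coordinate pairs to a bound by the sup norm in the chart `y = (y', 0)`: `Γ(y',0) ≥ 0` and
`Γ(y',0) ≥ ε|y'_k|` for every `k` ("≥ ε‖y‖_{ℝⁿ/𝟙ℝ}"). [cite: Borinsky2020, Lemma 15 (tropical.tex l.669–676)] -/
theorem gap_snoc_bounds {n : ℕ} {ε : ℝ} {Γ : (Fin (n + 1) → ℝ) → ℝ}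
    (hgap : ∀ y : Fin (n + 1) → ℝ, ∀ k k', ε * (y k - y k') ≤ Γ y) (y : Fin n → ℝ) :
    0 ≤ Γ (Fin.snoc (α := fun _ => ℝ) y 0) ∧ ∀ k, ε * |y k| ≤ Γ (Fin.snoc (α := fun _ => ℝ) y 0) := by
  refine ⟨?_, fun k => ?_⟩
  · have h := hgap (Fin.snoc (α := fun _ => ℝ) y 0) 0 0
    simp only [sub_self, mul_zero] at h
    exact h
  · rcases le_or_gt 0 (y k) with h | h
    · have h' := hgap (Fin.snoc (α := fun _ => ℝ) y 0) (Fin.castSucc k) (Fin.last n)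
      simp only [Fin.snoc_castSucc, Fin.snoc_last, sub_zero] at h'
      rwa [abs_of_nonneg h]
    · have h' := hgap (Fin.snoc (α := fun _ => ℝ) y 0) (Fin.last n) (Fin.castSucc k)
      simp only [Fin.snoc_castSucc, Fin.snoc_last, zero_sub, mul_neg] at h'
      rw [abs_of_neg h, mul_neg]
      exact h'

/-- `e^{−Γ} ≤ Π_k e^{−(ε/(n+1))|y_k|}` whenever `Γ ≥ 0` and `Γ ≥ ε|y_k|` for all `k` ("this exponent is falling sufficiently fast for
large y", l.666: `Γ ≥ ε‖y‖_∞ ≥ (ε/(n+1)) Σ_k |y_k|`). [cite: Borinsky2020, eq. (atrbtr_exp) and the sentence after it (tropical.tex l.663–666)] -/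
theorem exp_neg_le_prod_exp {n : ℕ} {ε Γ : ℝ} (hε : 0 < ε) (y : Fin n → ℝ) (hΓ0 : 0 ≤ Γ)
    (hΓk : ∀ k, ε * |y k| ≤ Γ) : exp (-Γ) ≤ ∏ k, exp (-(ε / (n + 1)) * |y k|) := by
  have hnorm : ε * ‖y‖ ≤ Γ := by
    have hy : ‖y‖ ≤ Γ / ε := by
      refine (pi_norm_le_iff_of_nonneg (div_nonneg hΓ0 hε.le)).2 fun k => ?_
      rw [Real.norm_eq_abs, le_div_iff₀ hε, mul_comm]
      exact hΓk k
    calc ε * ‖y‖ ≤ ε * (Γ / ε) := by gcongr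
      _ = Γ := mul_div_cancel₀ _ hε.ne'
  rw [← Real.exp_sum, Real.exp_le_exp, ← Finset.mul_sum, neg_mul, neg_le_neg_iff]
  have hs : ∑ k, |y k| ≤ (n + 1) * ‖y‖ := by
    calc ∑ k, |y k| ≤ ∑ _k : Fin n, ‖y‖ :=
          Finset.sum_le_sum fun k _ => by rw [← Real.norm_eq_abs]; exact norm_le_pi_norm y k
      _ = n * ‖y‖ := by simp
      _ ≤ (n + 1) * ‖y‖ := by rw [add_one_mul]; linarith [norm_nonneg y]
  calc ε / (n + 1) * ∑ k, |y k| ≤ ε / (n + 1) * ((n + 1) * ‖y‖) := by gcongr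
    _ = ε * ‖y‖ := by field_simp
    _ ≤ Γ := hnorm

/-- The chart `y ↦ (e^{y_0}, …, e^{y_{n−1}}, 1)` of `ℙⁿ_{>0}` (`x_n = 1`, logarithmic coordinates) is continuous. Plumbing.
[cite: Borinsky2020, eq. (integral_euler_mellin) (tropical.tex l.239); §4 (l.657–660, the map Exp)] -/
theorem continuous_expSnoc {n : ℕ} :
    Continuous fun y : Fin n → ℝ => fun k : Fin (n + 1) => exp (Fin.snoc (α := fun _ => ℝ) y 0 k) := by
  refine continuous_pi fun k => continuous_exp.comp ?_
  refine Fin.lastCases ?_ (fun i => ?_) k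
  · simp only [Fin.snoc_last]
    exact continuous_const
  · simp only [Fin.snoc_castSucc]
    exact continuous_apply i

/-- The face value `y ↦ max_{ℓ∈supp p}⟨y,ℓ⟩` (support function of `NP_p`) is continuous. Plumbing. [cite: Borinsky2020, Proposition 7] -/
theorem continuous_faceValue {σ : Type*} {p : MvPolynomial σ ℝ} (hp : p ≠ 0) :
    Continuous fun y : σ → ℝ => faceValue p y := by
  have h : (fun y : σ → ℝ => faceValue p y) =
      fun y => p.support.sup' (support_nonempty.mpr hp) (fun d => pairing y d) :=
    funext fun y => faceValue_of_ne_zero hp y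
  rw [h]
  refine Continuous.finset_sup'_apply _ fun d _ => ?_
  unfold pairing
  exact continuous_finsetSum _ fun i _ => (continuous_apply i).mul continuous_const

/-- **`I^tr < ∞` under the gap of Lemma 15 (hence under R1 ∧ R2):** the TROPICALLY APPROXIMATED integral
`I^tr = ∫ Π_i a_i^tr(x)^{ν_i}/Π_j b_j^tr(x)^{ρ_j} Ω` of eq. (integral_trop) — the normalisation of the tropical sampling measure `μ^tr` of
eq. (mu_probability) — converges absolutely in the chart `x_n = 1`, `x = e^y`: its integrand is `e^{−(max_ℬ−max_𝒜)(y)} ≤ e^{−ε‖y‖_∞}`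
by eq. (atrbtr_exp). No hypothesis on zeros (R3) is involved: only `a_i, b_j ≠ 0`. [cite: Borinsky2020, eq. (integral_trop) and eq. (mu_probability) (tropical.tex l.885–893); eq. (atrbtr_exp) (l.663–666); Lemma 15] -/
theorem integrable_tropical_of_gap {n : ℕ} {ι κ : Type*} [Fintype ι] [Fintype κ]
    (a : ι → MvPolynomial (Fin (n + 1)) ℝ) (b : κ → MvPolynomial (Fin (n + 1)) ℝ) (ν : ι → ℝ) (ρ : κ → ℝ)
    (ha : ∀ i, a i ≠ 0) (hb : ∀ j, b j ≠ 0) {ε : ℝ} (hε : 0 < ε)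
    (hgap : ∀ y : Fin (n + 1) → ℝ, ∀ k k',
      ε * (y k - y k') ≤ (∑ j, ρ j * faceValue (b j) y) - ∑ i, ν i * faceValue (a i) y) :
    Integrable (fun y : Fin n → ℝ =>
      (∏ i, trop (a i) (fun k => exp (Fin.snoc (α := fun _ => ℝ) y 0 k)) ^ ν i) /
        ∏ j, trop (b j) (fun k => exp (Fin.snoc (α := fun _ => ℝ) y 0 k)) ^ ρ j) := by
  set Γ : (Fin (n + 1) → ℝ) → ℝ := fun z => (∑ j, ρ j * faceValue (b j) z) - ∑ i, ν i * faceValue (a i) z with hΓ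
  have hfun : (fun y : Fin n → ℝ =>
      (∏ i, trop (a i) (fun k => exp (Fin.snoc (α := fun _ => ℝ) y 0 k)) ^ ν i) /
        ∏ j, trop (b j) (fun k => exp (Fin.snoc (α := fun _ => ℝ) y 0 k)) ^ ρ j) =
      fun y => exp (-Γ (Fin.snoc (α := fun _ => ℝ) y 0)) := by
    funext y
    rw [prod_trop_rpow_div_eq_exp a b ν ρ ha hb]
    congr 1
    simp only [hΓ]
    ring
  rw [hfun]
  have hsnoc : Continuous fun y : Fin n → ℝ => (Fin.snoc (α := fun _ => ℝ) y 0 : Fin (n + 1) → ℝ) := by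
    refine continuous_pi fun k => ?_
    refine Fin.lastCases ?_ (fun i => ?_) k
    · simp only [Fin.snoc_last]
      exact continuous_const
    · simp only [Fin.snoc_castSucc]
      exact continuous_apply i
  have hΓc : Continuous Γ := by
    simp only [hΓ]
    exact (continuous_finsetSum _ fun j _ => continuous_const.mul (continuous_faceValue (hb j))).sub
      (continuous_finsetSum _ fun i _ => continuous_const.mul (continuous_faceValue (ha i)))
  have hmeas : AEStronglyMeasurable (fun y : Fin n → ℝ => exp (-Γ (Fin.snoc (α := fun _ => ℝ) y 0))) volume :=
    (continuous_exp.comp ((hΓc.comp hsnoc).neg)).aestronglyMeasurable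
  refine (integrable_prod_exp_neg_mul_abs (n := n) (c := ε / (n + 1)) (by positivity)).mono' hmeas
    (ae_of_all _ fun y => ?_)
  obtain ⟨hΓ0, hΓk⟩ := gap_snoc_bounds hgap y
  rw [Real.norm_eq_abs, abs_of_pos (exp_pos _)]
  exact exp_neg_le_prod_exp hε y hΓ0 hΓk

/-- **Theorem 3, analytic core — the gap of Lemma 15 and R3 give absolute convergence.** In the affine chart `x_n = 1` of
`ℙ^{n−1}_{>0}` and logarithmic coordinates `x_k = e^{y_k}` (eq. (integral_euler_mellin): `Ω = Π_{k<n} dx_k/x_k = Π_k dy_k`), the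
integrand `Π_i |a_i(x)|^{ν_i} / Π_j |b_j(x)|^{ρ_j}` of eq. (integral) is Lebesgue-integrable over `y ∈ ℝ^{n−1}` as soon as the
support-function gap `max_ℬ⟨y,·⟩ − max_𝒜⟨y,·⟩ ≥ ε·(y_k − y_{k'})` of Lemma 15 holds and every `b_j` is completely non-vanishing on the
open orthant (R3): by eq. (atrbtr_exp) and Corollary 9 the integrand is `e^{−(max_ℬ − max_𝒜)(y)}·|R_{a/b}(e^y)| ≤ C e^{−ε‖y‖_∞}`
("this exponent is falling sufficiently fast for large y for the integral in eq. (integral) to be convergent", l.666; "Corollary 9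
implies that |R_{a/b}(x)| is bounded", l.857). Ambient dimension written `n + 1` (variables `x_0, …, x_n`, chart `x_n = 1`,
`y ∈ ℝⁿ`); real exponents `ν_i, ρ_j ≥ 0`; numerators `a_i ≠ 0`.
[cite: Borinsky2020, Theorem 3 (tropical.tex l.315–331); eq. (integral_euler_mellin) (l.239); eq. (atrbtr_exp) and l.666; proof of Theorem 3 (l.855–858)] -/
theorem integrable_of_gap {n : ℕ} {ι κ : Type*} [Fintype ι] [Fintype κ]
    (a : ι → MvPolynomial (Fin (n + 1)) ℝ) (b : κ → MvPolynomial (Fin (n + 1)) ℝ) (ν : ι → ℝ) (ρ : κ → ℝ)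
    (ha : ∀ i, a i ≠ 0) (hν : ∀ i, 0 ≤ ν i) (hρ : ∀ j, 0 ≤ ρ j)
    (hR3 : ∀ j, CompletelyNonVanishing (b j) {x | ∀ k, 0 < x k})
    {ε : ℝ} (hε : 0 < ε)
    (hgap : ∀ y : Fin (n + 1) → ℝ, ∀ k k',
      ε * (y k - y k') ≤ (∑ j, ρ j * faceValue (b j) y) - ∑ i, ν i * faceValue (a i) y) :
    Integrable (fun y : Fin n → ℝ =>
      (∏ i, |eval (fun k => exp (Fin.snoc (α := fun _ => ℝ) y 0 k)) (a i)| ^ ν i) /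
        ∏ j, |eval (fun k => exp (Fin.snoc (α := fun _ => ℝ) y 0 k)) (b j)| ^ ρ j) := by
  set X : (Fin n → ℝ) → (Fin (n + 1) → ℝ) := fun y k => exp (Fin.snoc (α := fun _ => ℝ) y 0 k) with hX
  have hXpos : ∀ y k, 0 < X y k := fun y k => exp_pos _
  have hbne : ∀ j, b j ≠ 0 := fun j h0 => by
    have h1 := hR3 j 0 (fun _ => 1) (fun _ => one_pos)
    simp [h0, trunc] at h1
  have hbX : ∀ y j, eval (X y) (b j) ≠ 0 := fun y j =>
    eval_ne_zero_of_completelyNonVanishing (hR3 j) (hXpos y)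
  -- continuity of the integrand (hence measurability)
  have hXc : Continuous X := continuous_expSnoc
  have hev : ∀ p : MvPolynomial (Fin (n + 1)) ℝ, Continuous fun y => eval (X y) p :=
    fun p => (MvPolynomial.continuous_eval p).comp hXc
  have hmeas : AEStronglyMeasurable
      (fun y => (∏ i, |eval (X y) (a i)| ^ ν i) / ∏ j, |eval (X y) (b j)| ^ ρ j) volume := by
    refine (Continuous.div ?_ ?_ fun y => ?_).aestronglyMeasurable
    · exact continuous_finsetProd _ fun i _ => ((hev (a i)).abs).rpow_const fun _ => Or.inr (hν i)
    · exact continuous_finsetProd _ fun j _ => ((hev (b j)).abs).rpow_const fun _ => Or.inr (hρ j)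
    · exact (Finset.prod_pos fun j _ => Real.rpow_pos_of_pos (abs_pos.2 (hbX y j)) _).ne'
  -- Corollary 9: the residual is bounded
  obtain ⟨C, hC0, hC⟩ := exists_abs_residual_le a b ν ρ hν hρ hR3
  refine ((integrable_prod_exp_neg_mul_abs (n := n) (c := ε / (n + 1)) (by positivity)).const_mul C).mono'
    hmeas (ae_of_all _ fun y => ?_)
  -- the pointwise bound at `x = X y`
  have hx : ∀ k, 0 < X y k := hXpos y
  set Γ := (∑ j, ρ j * faceValue (b j) (Fin.snoc (α := fun _ => ℝ) y 0)) -
    ∑ i, ν i * faceValue (a i) (Fin.snoc (α := fun _ => ℝ) y 0) with hΓ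
  obtain ⟨hΓ0, hΓk⟩ := gap_snoc_bounds (Γ := fun z => (∑ j, ρ j * faceValue (b j) z) - ∑ i, ν i * faceValue (a i) z)
    hgap y
  have hexp : exp (-Γ) ≤ ∏ k, exp (-(ε / (n + 1)) * |y k|) := exp_neg_le_prod_exp hε y hΓ0 hΓk
  -- positivity of the factors
  have hTa : 0 < ∏ i, trop (a i) (X y) ^ ν i :=
    Finset.prod_pos fun i _ => Real.rpow_pos_of_pos (trop_pos hx (ha i)) _
  have hTb : 0 < ∏ j, trop (b j) (X y) ^ ρ j :=
    Finset.prod_pos fun j _ => Real.rpow_pos_of_pos (trop_pos hx (hbne j)) _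
  have hB : 0 < ∏ j, |eval (X y) (b j)| ^ ρ j :=
    Finset.prod_pos fun j _ => Real.rpow_pos_of_pos (abs_pos.2 (hbX y j)) _
  have hA : 0 ≤ ∏ i, |eval (X y) (a i)| ^ ν i :=
    Finset.prod_nonneg fun i _ => Real.rpow_nonneg (abs_nonneg _) _
  -- factorisation `integrand = (tropical part) · |R_{a/b}|`
  have hfac : (∏ i, |eval (X y) (a i)| ^ ν i) / ∏ j, |eval (X y) (b j)| ^ ρ j =
      ((∏ i, trop (a i) (X y) ^ ν i) / ∏ j, trop (b j) (X y) ^ ρ j) *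
        ((∏ i, |eval (X y) (a i)| ^ ν i / trop (a i) (X y) ^ ν i) /
          ∏ j, |eval (X y) (b j)| ^ ρ j / trop (b j) (X y) ^ ρ j) := by
    rw [Finset.prod_div_distrib, Finset.prod_div_distrib]
    field_simp
  -- eq. (atrbtr_exp): the tropical part is `e^{−Γ}`
  have htrop : (∏ i, trop (a i) (X y) ^ ν i) / ∏ j, trop (b j) (X y) ^ ρ j = exp (-Γ) := by
    rw [hΓ, show X y = fun k => exp (Fin.snoc (α := fun _ => ℝ) y 0 k) from rfl,
      prod_trop_rpow_div_eq_exp a b ν ρ ha hbne]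
    congr 1
    ring
  rw [Real.norm_eq_abs, abs_of_nonneg (div_nonneg hA hB.le)]
  change (∏ i, |eval (X y) (a i)| ^ ν i) / ∏ j, |eval (X y) (b j)| ^ ρ j ≤ C * ∏ k, exp (-(ε / (n + 1)) * |y k|)
  rw [hfac, htrop]
  calc exp (-Γ) * ((∏ i, |eval (X y) (a i)| ^ ν i / trop (a i) (X y) ^ ν i) /
          ∏ j, |eval (X y) (b j)| ^ ρ j / trop (b j) (X y) ^ ρ j)
        ≤ exp (-Γ) * C := by gcongr; exact hC (X y) hx
    _ ≤ (∏ k, exp (-(ε / (n + 1)) * |y k|)) * C := by gcongr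
    _ = C * ∏ k, exp (-(ε / (n + 1)) * |y k|) := mul_comm _ _

/-- **Theorem 3 (Borinsky 2020), AS PRINTED, in the kernel.** "The integral in eq. (integral) is convergent if (R1) the denominator
polytope ℬ is (n−1)-dimensional, (R2) the numerator polytope 𝒜 is contained in the relative interior of ℬ: 𝒜 ⊂ relint ℬ, (R3) all the
denominator polynomials {b_j} are completely non-vanishing on ℙ^{n−1}_{>0}", where `𝒜 = Σ_i (Re ν_i) NP_{a_i}`, `ℬ = Σ_j (Re ρ_j) NP_{b_j}`
and the `a_i`, `b_j` are homogeneous with `Σ_i ν_i deg a_i = Σ_j ρ_j deg b_j` (eq. (homogeneous), Remark 4). TYPED: variables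
`x_0, …, x_n` (ambient `ℝ^{n+1}`, so "(n−1)-dimensional" reads `finrank (vectorSpan ℝ ℬ) = n`), relative interior = Mathlib's
`intrinsicInterior ℝ ℬ`, REAL exponents `ν_i, ρ_j ≥ 0` (the weights of the Minkowski sums; TODO(general form): complex `ν, ρ` with
`|a^ν| = |a|^{Re ν}`), numerators `a_i ≠ 0`, denominators homogeneous (the numerators' homogeneity and eq. (homogeneous) are what places
`𝒜` in the hyperplane of `ℬ` — Remark 4 — and are implied by R2 as typed, so they are not separate hypotheses); CONCLUSION: the
integral of eq. (integral) written in the chart `x_n = 1` with logarithmic coordinates (eq. (integral_euler_mellin), `Π dx_k/x_k = dy`)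
converges absolutely, i.e. `y ↦ Π_i |a_i(e^{(y,0)})|^{ν_i} / Π_j |b_j(e^{(y,0)})|^{ρ_j}` is Lebesgue-integrable on `ℝⁿ` (the companion
`integrableOn_of_R1_R2_R3` states the same in the coordinates `x` of eq. (integral_euler_mellin)). PROOF ROUTE: the printed one —
Lemma 15 (`ball_of_R1_R2`, `gap_of_ball`), eq. (atrbtr_exp), Corollary 9 (`exists_abs_residual_le` in `TropicalLowerBound.lean`) — with
the sector sum of Theorem 19 replaced by the direct domination `≤ C e^{−ε‖y‖}` that the sentence after eq. (atrbtr_exp) states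
(l.666); see `integrable_of_gap`.
[cite: Borinsky2020, Theorem 3 (tropical.tex l.315–331); Remark 4 (l.333–337); Lemma 15 (l.669–688); proof of Theorem 3 (l.855–858)] -/
theorem integrable_of_R1_R2_R3 {n : ℕ} {ι κ : Type*} [Fintype ι] [Fintype κ]
    (a : ι → MvPolynomial (Fin (n + 1)) ℝ) (b : κ → MvPolynomial (Fin (n + 1)) ℝ) (ν : ι → ℝ) (ρ : κ → ℝ)
    (ha : ∀ i, a i ≠ 0) (hν : ∀ i, 0 ≤ ν i) (hρ : ∀ j, 0 ≤ ρ j)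
    {db : κ → ℕ} (hhb : ∀ j, (b j).IsHomogeneous (db j))
    (hR1 : Module.finrank ℝ (vectorSpan ℝ (∑ j, ρ j • NP⟦b j⟧)) = n)
    (hR2 : (∑ i, ν i • NP⟦a i⟧) ⊆ intrinsicInterior ℝ (∑ j, ρ j • NP⟦b j⟧))
    (hR3 : ∀ j, CompletelyNonVanishing (b j) {x | ∀ k, 0 < x k}) :
    Integrable (fun y : Fin n → ℝ =>
      (∏ i, |eval (fun k => exp (Fin.snoc (α := fun _ => ℝ) y 0 k)) (a i)| ^ ν i) /
        ∏ j, |eval (fun k => exp (Fin.snoc (α := fun _ => ℝ) y 0 k)) (b j)| ^ ρ j) := by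
  obtain ⟨δ, hδ, hball⟩ := ball_of_R1_R2 a b ν ρ ha hhb hR1 hR2
  exact integrable_of_gap a b ν ρ ha hν hρ hR3 hδ fun y k k' => gap_of_ball a b ν ρ ha hρ hδ.le hball y k k'

/-- **`I^tr < ∞` under R1 ∧ R2** (the normalisation of the tropical sampling measure, eq. (integral_trop) / (mu_probability), for
homogeneous denominators): Lemma 15 + eq. (atrbtr_exp); no use of R3. [cite: Borinsky2020, eq. (integral_trop) (tropical.tex l.885–887); Lemma 15; Theorem 19 ("the prefactor … is finite")] -/
theorem integrable_tropical_of_R1_R2 {n : ℕ} {ι κ : Type*} [Fintype ι] [Fintype κ]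
    (a : ι → MvPolynomial (Fin (n + 1)) ℝ) (b : κ → MvPolynomial (Fin (n + 1)) ℝ) (ν : ι → ℝ) (ρ : κ → ℝ)
    (ha : ∀ i, a i ≠ 0) (hb : ∀ j, b j ≠ 0) (hρ : ∀ j, 0 ≤ ρ j)
    {db : κ → ℕ} (hhb : ∀ j, (b j).IsHomogeneous (db j))
    (hR1 : Module.finrank ℝ (vectorSpan ℝ (∑ j, ρ j • NP⟦b j⟧)) = n)
    (hR2 : (∑ i, ν i • NP⟦a i⟧) ⊆ intrinsicInterior ℝ (∑ j, ρ j • NP⟦b j⟧)) :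
    Integrable (fun y : Fin n → ℝ =>
      (∏ i, trop (a i) (fun k => exp (Fin.snoc (α := fun _ => ℝ) y 0 k)) ^ ν i) /
        ∏ j, trop (b j) (fun k => exp (Fin.snoc (α := fun _ => ℝ) y 0 k)) ^ ρ j) := by
  obtain ⟨δ, hδ, hball⟩ := ball_of_R1_R2 a b ν ρ ha hhb hR1 hR2
  exact integrable_tropical_of_gap a b ν ρ ha hb hδ fun y k k' => gap_of_ball a b ν ρ ha hρ hδ.le hball y k k'

/-! ### The same in the coordinates of eq. (integral_euler_mellin): `∫_{ℝ^{n−1}_{>0}} (…)|_{x_n = 1} Π_k dx_k/x_k` -/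

/-- The logarithmic chart: for every `G`, `∫_{x > 0} G(x) Π_k dx_k/x_k` converges absolutely iff `∫_{ℝⁿ} G(e^y) dy` does
("Start by changing to logarithmic coordinates x = e^y", Lemma 17's proof; the Jacobian of `y ↦ e^y` is `Π_k x_k`).
[cite: Borinsky2020, eq. (integral_euler_mellin) (tropical.tex l.239); proof of Lemma 17 (l.762)] -/
theorem integrableOn_mul_prod_inv_iff_integrable_exp {n : ℕ} (G : (Fin n → ℝ) → ℝ) :
    IntegrableOn (fun x : Fin n → ℝ => G x * ∏ k, (x k)⁻¹) {x | ∀ k, 0 < x k} ↔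
      Integrable (fun y : Fin n → ℝ => G (fun k => exp (y k))) := by
  have hderiv : ∀ y ∈ (Set.univ : Set (Fin n → ℝ)), HasFDerivWithinAt (fun (y : Fin n → ℝ) (k : Fin n) => exp (y k))
      (coneMap (Matrix.diagonal fun k => exp (y k))) Set.univ y := by
    intro y _
    refine HasFDerivAt.hasFDerivWithinAt ?_
    have h : HasFDerivAt (fun (x : Fin n → ℝ) (k : Fin n) => exp (x k))
        (ContinuousLinearMap.pi fun k =>
          exp (y k) • ContinuousLinearMap.proj (R := ℝ) (φ := fun _ : Fin n => ℝ) k) y := by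
      rw [hasFDerivAt_pi]
      intro k
      have h1 : HasFDerivAt (fun f : Fin n → ℝ => f k)
          (ContinuousLinearMap.proj (R := ℝ) (φ := fun _ : Fin n => ℝ) k) y := hasFDerivAt_apply k y
      exact (Real.hasDerivAt_exp (y k)).comp_hasFDerivAt y h1
    have heq : (ContinuousLinearMap.pi fun k =>
          exp (y k) • ContinuousLinearMap.proj (R := ℝ) (φ := fun _ : Fin n => ℝ) k)
        = coneMap (Matrix.diagonal fun k => exp (y k)) := by
      ext v k
      simp [coneMap_apply, Matrix.mulVec_diagonal]
    rw [← heq]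
    exact h
  have hinj : Set.InjOn (fun (y : Fin n → ℝ) (k : Fin n) => exp (y k)) Set.univ :=
    fun y _ y' _ h => funext fun k => Real.exp_eq_exp.1 (congr_fun h k)
  have himage : (fun (y : Fin n → ℝ) (k : Fin n) => exp (y k)) '' Set.univ = {x | ∀ k, 0 < x k} := by
    ext x
    constructor
    · rintro ⟨y, -, rfl⟩ k
      exact exp_pos _
    · intro hx
      exact ⟨fun k => Real.log (x k), Set.mem_univ _, funext fun k => Real.exp_log (hx k)⟩
  have h := integrableOn_image_iff_integrableOn_abs_det_fderiv_smul volume MeasurableSet.univ hderiv hinj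
    (fun x => G x * ∏ k, (x k)⁻¹)
  rw [himage, integrableOn_univ] at h
  rw [h]
  refine integrable_congr (ae_of_all _ fun y => ?_)
  have hP : 0 < ∏ k, exp (y k) := Finset.prod_pos fun k _ => exp_pos _
  simp only [det_coneMap, Matrix.det_diagonal, smul_eq_mul, Finset.prod_inv_distrib, abs_of_pos hP]
  field_simp

/-- In the chart `x_n = 1`: `(e^{y_0}, …, e^{y_{n−1}}, 1) = e^{(y, 0)}`. Plumbing. [cite: Borinsky2020, eq. (integral_euler_mellin) (tropical.tex l.239)] -/
theorem snoc_exp_one {n : ℕ} (y : Fin n → ℝ) :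
    (Fin.snoc (α := fun _ => ℝ) (fun k => exp (y k)) 1 : Fin (n + 1) → ℝ) =
      fun k => exp (Fin.snoc (α := fun _ => ℝ) y 0 k) := by
  funext k
  refine Fin.lastCases ?_ (fun i => ?_) k
  · simp only [Fin.snoc_last, Real.exp_zero]
  · simp only [Fin.snoc_castSucc]

/-- **Theorem 3 in the coordinates of eq. (integral_euler_mellin)**: under R1, R2, R3 (typed as in `integrable_of_R1_R2_R3`) the
Euler–Mellin form of the integral, "I = ∫_{ℝ^{n−1}_{>0}} (Π_i a_i(x)^{ν_i}/Π_j b_j(x)^{ρ_j})|_{x_n=1} Π_{k=1}^{n−1} dx_k/x_k", converges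
absolutely: `x ↦ (Π_i |a_i(x,1)|^{ν_i}/Π_j |b_j(x,1)|^{ρ_j})·Π_k x_k⁻¹` is Lebesgue-integrable on the open orthant `ℝⁿ_{>0}`.
[cite: Borinsky2020, Theorem 3 (tropical.tex l.315–331); eq. (integral_euler_mellin) (l.237–241)] -/
theorem integrableOn_of_R1_R2_R3 {n : ℕ} {ι κ : Type*} [Fintype ι] [Fintype κ]
    (a : ι → MvPolynomial (Fin (n + 1)) ℝ) (b : κ → MvPolynomial (Fin (n + 1)) ℝ) (ν : ι → ℝ) (ρ : κ → ℝ)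
    (ha : ∀ i, a i ≠ 0) (hν : ∀ i, 0 ≤ ν i) (hρ : ∀ j, 0 ≤ ρ j)
    {db : κ → ℕ} (hhb : ∀ j, (b j).IsHomogeneous (db j))
    (hR1 : Module.finrank ℝ (vectorSpan ℝ (∑ j, ρ j • NP⟦b j⟧)) = n)
    (hR2 : (∑ i, ν i • NP⟦a i⟧) ⊆ intrinsicInterior ℝ (∑ j, ρ j • NP⟦b j⟧))
    (hR3 : ∀ j, CompletelyNonVanishing (b j) {x | ∀ k, 0 < x k}) :
    IntegrableOn (fun x : Fin n → ℝ =>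
      (∏ i, |eval (Fin.snoc (α := fun _ => ℝ) x 1) (a i)| ^ ν i) /
        (∏ j, |eval (Fin.snoc (α := fun _ => ℝ) x 1) (b j)| ^ ρ j) * ∏ k, (x k)⁻¹) {x | ∀ k, 0 < x k} := by
  refine (integrableOn_mul_prod_inv_iff_integrable_exp (fun x : Fin n → ℝ =>
    (∏ i, |eval (Fin.snoc (α := fun _ => ℝ) x 1) (a i)| ^ ν i) /
      ∏ j, |eval (Fin.snoc (α := fun _ => ℝ) x 1) (b j)| ^ ρ j)).2 ?_
  simp only [snoc_exp_one]
  exact integrable_of_R1_R2_R3 a b ν ρ ha hν hρ hhb hR1 hR2 hR3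

/-! ### Generalized permutahedra (§6): on a Weyl chamber the tropical part is ONE monomial (Lemma 16 / proof of Theorem 27), and Theorem 27's hypotheses give Theorem 3's conclusion -/

/-- **Lemma 26 ⇒ the support function of a generalized permutahedron on the Weyl chamber `C_σ`**: if the weighted Minkowski sum
`𝒜 = Σ_i ν_i NP_{a_i}` IS the generalized permutahedron `𝒢_z` (as a set; `z` supermodular with `z(∅) = 0` — Theorem 27's hypothesis
"𝒜 … are generalized permutahedra … with the associated boolean functions z_𝒜"), then for every `y ∈ C_σ` the support function
`Σ_i ν_i max_{ℓ∈supp a_i}⟨y,ℓ⟩ = max_{v∈𝒜}⟨y,v⟩` equals `⟨y, w^{(σ,z)}⟩` at the Fujishige–Tomizawa vertex ("By Lemma 26 we have vertices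
w^{(σ,z_𝒜)} ∈ 𝒜 … such that ⟨y, w^{(σ,z_𝒜)}⟩ = max_{v∈𝒜}⟨y,v⟩ … for all σ ∈ S_n and y ∈ C_σ").
[cite: Borinsky2020, proof of Theorem 27 (tropical.tex l.1075–1079); Lemma 26 (l.1047–1057)] -/
theorem sum_faceValue_eq_dotProduct_ftVertex {ι : Type*} [Fintype ι] (a : ι → MvPolynomial (Fin m) ℝ)
    (ha : ∀ i, a i ≠ 0) {ν : ι → ℝ} (hν : ∀ i, 0 ≤ ν i) {z : Finset (Fin m) → ℝ} (hz : Supermodular z) (h0 : z ∅ = 0)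
    (hA : (∑ i, ν i • NP⟦a i⟧) = gpPolytope z) {σ : Equiv.Perm (Fin m)} {y : Fin m → ℝ} (hy : y ∈ weylChamber σ) :
    ∑ i, ν i * faceValue (a i) y = y ⬝ᵥ ftVertex z σ := by
  apply le_antisymm
  · obtain ⟨v, hv, hyv⟩ := exists_mem_minkowskiSum_dotProduct_eq a ha ν y
    rw [← hyv]
    rw [hA] at hv
    exact inner_le_inner_ftVertex h0 σ hy hv
  · have hw : ftVertex z σ ∈ ∑ i, ν i • NP⟦a i⟧ := by
      rw [hA]
      exact ftVertex_mem_gpPolytope hz h0 σ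
    exact dotProduct_le_of_mem_minkowskiSum a hν y hw

/-- **Lemma 16 for generalized permutahedra (the monomial of Theorem 27 / eq. (40))**: if `𝒜 = 𝒢_{z_𝒜}` and `ℬ = 𝒢_{z_ℬ}` are
generalized permutahedra, then on the exponentiated Weyl chamber `Exp(C_σ)` the tropical part of the integrand is the single monomial
`x^{−w}`, `w = w^{(σ,z_ℬ)} − w^{(σ,z_𝒜)}`: `Π_i a_i^tr(e^y)^{ν_i}/Π_j b_j^tr(e^y)^{ρ_j} = e^{−⟨y, w⟩}` for `y ∈ C_σ` ("the exponentiated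
cones … as the domains where the function Π_i a_i^tr(x)^{Re ν_i}/Π_j b_j^tr(x)^{Re ρ_j} behaves like a monomial": Lemma 16, here for the
braid-fan cones of Theorem 27). Its chain-set exponents are `Σ_{i∈A^σ_k} w_i = z_ℬ(A^σ_k) − z_𝒜(A^σ_k) = −r(A^σ_k)` in the notation
`r = z_𝒜 − z_ℬ` of eq. (40) (`sum_chainSet_ftVertex` of the companion; the printed "⟨u^{(σ,k)}, w^{(σ,z_𝒜)}⟩ = −z_𝒜(A^σ_k)").
[cite: Borinsky2020, Lemma 16 (tropical.tex l.702–710); Theorem 27 and its proof (l.1063–1085); eq. (40) (l.1104–1106)] -/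
theorem prod_trop_rpow_div_eq_exp_neg_dotProduct_of_gp {ι κ : Type*} [Fintype ι] [Fintype κ]
    (a : ι → MvPolynomial (Fin m) ℝ) (b : κ → MvPolynomial (Fin m) ℝ) {ν : ι → ℝ} {ρ : κ → ℝ}
    (ha : ∀ i, a i ≠ 0) (hb : ∀ j, b j ≠ 0) (hν : ∀ i, 0 ≤ ν i) (hρ : ∀ j, 0 ≤ ρ j)
    {zA zB : Finset (Fin m) → ℝ} (hzA : Supermodular zA) (hzB : Supermodular zB) (h0A : zA ∅ = 0) (h0B : zB ∅ = 0)
    (hA : (∑ i, ν i • NP⟦a i⟧) = gpPolytope zA) (hB : (∑ j, ρ j • NP⟦b j⟧) = gpPolytope zB)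
    {σ : Equiv.Perm (Fin m)} {y : Fin m → ℝ} (hy : y ∈ weylChamber σ) :
    (∏ i, trop (a i) (fun k => exp (y k)) ^ ν i) / ∏ j, trop (b j) (fun k => exp (y k)) ^ ρ j =
      exp (-(y ⬝ᵥ (ftVertex zB σ - ftVertex zA σ))) := by
  rw [prod_trop_rpow_div_eq_exp a b ν ρ ha hb, sum_faceValue_eq_dotProduct_ftVertex a ha hν hzA h0A hA hy,
    sum_faceValue_eq_dotProduct_ftVertex b hb hρ hzB h0B hB hy, dotProduct_sub]
  congr 1
  ring

/-- The chain-set exponents of that monomial: `Σ_{i∈A^σ_k} (w^{(σ,z_ℬ)} − w^{(σ,z_𝒜)})_i = −(z_𝒜(A^σ_k) − z_ℬ(A^σ_k)) = −r(A^σ_k)`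
(eq. (40): "r(A) = z_𝒜(A) − z_ℬ(A)"; the exponents telescope by Lemma 26). [cite: Borinsky2020, eq. (40) (tropical.tex l.1104–1106); proof of Theorem 27 (l.1079)] -/
theorem sum_chainSet_ftVertex_sub {zA zB : Finset (Fin m) → ℝ} (h0A : zA ∅ = 0) (h0B : zB ∅ = 0)
    (σ : Equiv.Perm (Fin m)) {k : ℕ} (hk : k ≤ m) :
    ∑ i ∈ chainSet σ k, (ftVertex zB σ - ftVertex zA σ) i = -(zA (chainSet σ k) - zB (chainSet σ k)) := by
  simp only [Pi.sub_apply, Finset.sum_sub_distrib, sum_chainSet_ftVertex zB σ h0B hk, sum_chainSet_ftVertex zA σ h0A hk]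
  ring

/-- **Theorem 27's hypotheses give Theorem 3's conclusion** (generalized-permutahedron form of R2 via Corollary 24): if
`𝒜 = Σ_i ν_i NP_{a_i} = 𝒢_{z_𝒜}` and `ℬ = Σ_j ρ_j NP_{b_j} = 𝒢_{z_ℬ}` as sets with `z_ℬ(∅) = 0`, `r(A) = z_𝒜(A) − z_ℬ(A) > 0` for every
non-empty proper `A` and `z_𝒜([n]) = z_ℬ([n])` ("generalized permutahedra … which fulfill the requirements R1–R3 of Theorem 3";
"r(A) > 0 for all non-empty proper subsets"), and R1, R3 hold, then the integral of eq. (integral_euler_mellin) converges absolutely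
(conclusion as in `integrable_of_R1_R2_R3`; R2 is `gpPolytope_subset_intrinsicInterior` of `GeneralizedPermutahedronInterior.lean`).
[cite: Borinsky2020, Theorem 27 (tropical.tex l.1063–1072); Corollary 24 (l.1024–1033); eq. (40) (l.1104–1106)] -/
theorem integrable_of_gp {n : ℕ} {ι κ : Type*} [Fintype ι] [Fintype κ]
    (a : ι → MvPolynomial (Fin (n + 1)) ℝ) (b : κ → MvPolynomial (Fin (n + 1)) ℝ) (ν : ι → ℝ) (ρ : κ → ℝ)
    (ha : ∀ i, a i ≠ 0) (hν : ∀ i, 0 ≤ ν i) (hρ : ∀ j, 0 ≤ ρ j)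
    {db : κ → ℕ} (hhb : ∀ j, (b j).IsHomogeneous (db j))
    {zA zB : Finset (Fin (n + 1)) → ℝ} (h0B : zB ∅ = 0)
    (hA : (∑ i, ν i • NP⟦a i⟧) = gpPolytope zA) (hB : (∑ j, ρ j • NP⟦b j⟧) = gpPolytope zB)
    (hr : ∀ A : Finset (Fin (n + 1)), A.Nonempty → A ≠ univ → zB A < zA A) (htop : zA univ = zB univ)
    (hR1 : Module.finrank ℝ (vectorSpan ℝ (∑ j, ρ j • NP⟦b j⟧)) = n)
    (hR3 : ∀ j, CompletelyNonVanishing (b j) {x | ∀ k, 0 < x k}) :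
    Integrable (fun y : Fin n → ℝ =>
      (∏ i, |eval (fun k => exp (Fin.snoc (α := fun _ => ℝ) y 0 k)) (a i)| ^ ν i) /
        ∏ j, |eval (fun k => exp (Fin.snoc (α := fun _ => ℝ) y 0 k)) (b j)| ^ ρ j) := by
  refine integrable_of_R1_R2_R3 a b ν ρ ha hν hρ hhb hR1 ?_ hR3
  rw [hA, hB]
  exact gpPolytope_subset_intrinsicInterior h0B hr htop

/-! ### §5 eq. (mu_probability): the tropical probability measure `μ^tr` and `I = I^tr ∫ R_{a/b} μ^tr` -/

/-- **eq. (mu_probability), the normalisation** ("such that 1 = ∫ μ^tr"): for a non-negative integrable weight `T` with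
`I^tr = ∫ T > 0` on any measure space, `μ^tr := (T/I^tr)·vol` is a probability measure. Typed for an ABSTRACT weight (Mathlib's
`withDensity`); the weight of the paper is the tropical part `Π_i a_i^tr^{ν_i}/Π_j b_j^tr^{ρ_j}` in the chart `x_n = 1`, `x = e^y` —
`isProbabilityMeasure_tropicalMeasure` below. [cite: Borinsky2020, eq. (mu_probability) (tropical.tex l.890–893)] -/
theorem isProbabilityMeasure_withDensity_div_integral {𝓧 : Type*} [MeasurableSpace 𝓧] {vol : Measure 𝓧} {T : 𝓧 → ℝ}
    (hT : Integrable T vol) (hT0 : ∀ x, 0 ≤ T x) (hI : 0 < ∫ x, T x ∂vol) :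
    IsProbabilityMeasure (vol.withDensity fun x => ENNReal.ofReal (T x / ∫ x', T x' ∂vol)) := by
  refine ⟨?_⟩
  rw [withDensity_apply _ MeasurableSet.univ, Measure.restrict_univ,
    ← ofReal_integral_eq_lintegral_ofReal (hT.div_const _) (ae_of_all _ fun x => div_nonneg (hT0 x) hI.le),
    integral_div, div_self hI.ne', ENNReal.ofReal_one]

/-- **"The integral in eq. (integral) can now be written as, I = I^tr ∫ R_{a/b}(x) μ^tr"** — the change of measure behind Algorithm 2,
for an ABSTRACT measurable weight `T ≥ 0` with `I^tr = ∫ T > 0` and any `R`: `∫ T·R dvol = I^tr · ∫ R dμ^tr`, `μ^tr = (T/I^tr)·vol`.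
[cite: Borinsky2020, §5 after eq. (mu_probability) (tropical.tex l.893–895)] -/
theorem integral_mul_eq_integral_mul_integral_withDensity {𝓧 : Type*} [MeasurableSpace 𝓧] {vol : Measure 𝓧} {T : 𝓧 → ℝ}
    (hTm : Measurable T) (hT0 : ∀ x, 0 ≤ T x) (hI : 0 < ∫ x, T x ∂vol) (R : 𝓧 → ℝ) :
    ∫ x, T x * R x ∂vol =
      (∫ x, T x ∂vol) * ∫ x, R x ∂(vol.withDensity fun x => ENNReal.ofReal (T x / ∫ x', T x' ∂vol)) := by
  rw [integral_withDensity_eq_integral_toReal_smul (hTm.div_const _).ennreal_ofReal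
    (ae_of_all _ fun _ => ENNReal.ofReal_lt_top)]
  simp_rw [ENNReal.toReal_ofReal (div_nonneg (hT0 _) hI.le), smul_eq_mul]
  rw [← integral_const_mul]
  refine integral_congr_ae (ae_of_all _ fun x => ?_)
  field_simp

/-- In the chart `x_n = 1`, `x = e^y`: under the gap of Lemma 15 the tropically approximated integral is POSITIVE, `0 < I^tr` ("that I^tr
is finite and that I^tr > 0, provided that the conditions R1 and R2 … are fulfilled"). [cite: Borinsky2020, §5 (tropical.tex l.897)] -/
theorem integral_tropical_pos_of_gap {n : ℕ} {ι κ : Type*} [Fintype ι] [Fintype κ]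
    (a : ι → MvPolynomial (Fin (n + 1)) ℝ) (b : κ → MvPolynomial (Fin (n + 1)) ℝ) (ν : ι → ℝ) (ρ : κ → ℝ)
    (ha : ∀ i, a i ≠ 0) (hb : ∀ j, b j ≠ 0) {ε : ℝ} (hε : 0 < ε)
    (hgap : ∀ y : Fin (n + 1) → ℝ, ∀ k k',
      ε * (y k - y k') ≤ (∑ j, ρ j * faceValue (b j) y) - ∑ i, ν i * faceValue (a i) y) :
    0 < ∫ y : Fin n → ℝ, (∏ i, trop (a i) (fun k => exp (Fin.snoc (α := fun _ => ℝ) y 0 k)) ^ ν i) /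
        ∏ j, trop (b j) (fun k => exp (Fin.snoc (α := fun _ => ℝ) y 0 k)) ^ ρ j := by
  have hpos : ∀ y : Fin n → ℝ, 0 < (∏ i, trop (a i) (fun k => exp (Fin.snoc (α := fun _ => ℝ) y 0 k)) ^ ν i) /
      ∏ j, trop (b j) (fun k => exp (Fin.snoc (α := fun _ => ℝ) y 0 k)) ^ ρ j := fun y =>
    div_pos (Finset.prod_pos fun i _ => Real.rpow_pos_of_pos (trop_pos (fun _ => exp_pos _) (ha i)) _)
      (Finset.prod_pos fun j _ => Real.rpow_pos_of_pos (trop_pos (fun _ => exp_pos _) (hb j)) _)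
  rw [integral_pos_iff_support_of_nonneg (fun y => (hpos y).le) (integrable_tropical_of_gap a b ν ρ ha hb hε hgap)]
  have hsupp : Function.support (fun y : Fin n → ℝ =>
      (∏ i, trop (a i) (fun k => exp (Fin.snoc (α := fun _ => ℝ) y 0 k)) ^ ν i) /
        ∏ j, trop (b j) (fun k => exp (Fin.snoc (α := fun _ => ℝ) y 0 k)) ^ ρ j) = Set.univ :=
    Set.eq_univ_of_forall fun y => (hpos y).ne'
  rw [hsupp]
  exact isOpen_univ.measure_pos volume Set.univ_nonempty

/-- **`μ^tr` is a probability measure** (eq. (mu_probability)) — the CONCRETE instance: in the chart `x_n = 1`, `x = e^y` of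
eq. (integral_euler_mellin), under the gap of Lemma 15 (hence under R1 ∧ R2), the measure on `ℝⁿ` with Lebesgue density
`T(y)/I^tr`, `T = Π_i a_i^tr(e^{(y,0)})^{ν_i}/Π_j b_j^tr(e^{(y,0)})^{ρ_j}`, `I^tr = ∫ T`, has total mass `1`.
[cite: Borinsky2020, eq. (mu_probability) (tropical.tex l.890–893); l.897] -/
theorem isProbabilityMeasure_tropicalMeasure_of_gap {n : ℕ} {ι κ : Type*} [Fintype ι] [Fintype κ]
    (a : ι → MvPolynomial (Fin (n + 1)) ℝ) (b : κ → MvPolynomial (Fin (n + 1)) ℝ) (ν : ι → ℝ) (ρ : κ → ℝ)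
    (ha : ∀ i, a i ≠ 0) (hb : ∀ j, b j ≠ 0) {ε : ℝ} (hε : 0 < ε)
    (hgap : ∀ y : Fin (n + 1) → ℝ, ∀ k k',
      ε * (y k - y k') ≤ (∑ j, ρ j * faceValue (b j) y) - ∑ i, ν i * faceValue (a i) y) :
    IsProbabilityMeasure ((volume : Measure (Fin n → ℝ)).withDensity fun y => ENNReal.ofReal
      (((∏ i, trop (a i) (fun k => exp (Fin.snoc (α := fun _ => ℝ) y 0 k)) ^ ν i) /
          ∏ j, trop (b j) (fun k => exp (Fin.snoc (α := fun _ => ℝ) y 0 k)) ^ ρ j) /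
        ∫ y' : Fin n → ℝ, (∏ i, trop (a i) (fun k => exp (Fin.snoc (α := fun _ => ℝ) y' 0 k)) ^ ν i) /
          ∏ j, trop (b j) (fun k => exp (Fin.snoc (α := fun _ => ℝ) y' 0 k)) ^ ρ j)) :=
  isProbabilityMeasure_withDensity_div_integral (integrable_tropical_of_gap a b ν ρ ha hb hε hgap)
    (fun _ => (div_pos (Finset.prod_pos fun i _ => Real.rpow_pos_of_pos (trop_pos (fun _ => exp_pos _) (ha i)) _)
      (Finset.prod_pos fun j _ => Real.rpow_pos_of_pos (trop_pos (fun _ => exp_pos _) (hb j)) _)).le)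
    (integral_tropical_pos_of_gap a b ν ρ ha hb hε hgap)

/-- **"I = I^tr ∫ R_{a/b} μ^tr"** — the CONCRETE instance for the modulus integrand of Theorem 3 in the chart `x_n = 1`, `x = e^y`:
with `T` the tropical part, `I^tr = ∫ T`, `μ^tr = (T/I^tr)·dy` and `|R_{a/b}| = (Π_i |a_i|^{ν_i}/Π_j |b_j|^{ρ_j}) / T`, the convergent
integral of `integrable_of_gap` equals `I^tr · ∫ |R_{a/b}| dμ^tr` — the expectation that Algorithm 2 estimates (the companion
`TropicalSamplingEstimator.lean` takes `μ^tr` and `R` from here on abstractly). [cite: Borinsky2020, §5 eq. (mu_probability) and the display after it (tropical.tex l.890–895); Algorithm 2 (l.897–906)] -/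
theorem integral_eq_integral_tropical_mul_integral_residual {n : ℕ} {ι κ : Type*} [Fintype ι] [Fintype κ]
    (a : ι → MvPolynomial (Fin (n + 1)) ℝ) (b : κ → MvPolynomial (Fin (n + 1)) ℝ) (ν : ι → ℝ) (ρ : κ → ℝ)
    (ha : ∀ i, a i ≠ 0) (hb : ∀ j, b j ≠ 0) {ε : ℝ} (hε : 0 < ε)
    (hgap : ∀ y : Fin (n + 1) → ℝ, ∀ k k',
      ε * (y k - y k') ≤ (∑ j, ρ j * faceValue (b j) y) - ∑ i, ν i * faceValue (a i) y) :
    ∫ y : Fin n → ℝ, (∏ i, |eval (fun k => exp (Fin.snoc (α := fun _ => ℝ) y 0 k)) (a i)| ^ ν i) /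
        ∏ j, |eval (fun k => exp (Fin.snoc (α := fun _ => ℝ) y 0 k)) (b j)| ^ ρ j =
      (∫ y : Fin n → ℝ, (∏ i, trop (a i) (fun k => exp (Fin.snoc (α := fun _ => ℝ) y 0 k)) ^ ν i) /
          ∏ j, trop (b j) (fun k => exp (Fin.snoc (α := fun _ => ℝ) y 0 k)) ^ ρ j) *
      ∫ y : Fin n → ℝ, ((∏ i, |eval (fun k => exp (Fin.snoc (α := fun _ => ℝ) y 0 k)) (a i)| ^ ν i) /
          ∏ j, |eval (fun k => exp (Fin.snoc (α := fun _ => ℝ) y 0 k)) (b j)| ^ ρ j) /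
        ((∏ i, trop (a i) (fun k => exp (Fin.snoc (α := fun _ => ℝ) y 0 k)) ^ ν i) /
          ∏ j, trop (b j) (fun k => exp (Fin.snoc (α := fun _ => ℝ) y 0 k)) ^ ρ j)
        ∂((volume : Measure (Fin n → ℝ)).withDensity fun y => ENNReal.ofReal
          (((∏ i, trop (a i) (fun k => exp (Fin.snoc (α := fun _ => ℝ) y 0 k)) ^ ν i) /
              ∏ j, trop (b j) (fun k => exp (Fin.snoc (α := fun _ => ℝ) y 0 k)) ^ ρ j) /
            ∫ y' : Fin n → ℝ, (∏ i, trop (a i) (fun k => exp (Fin.snoc (α := fun _ => ℝ) y' 0 k)) ^ ν i) /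
              ∏ j, trop (b j) (fun k => exp (Fin.snoc (α := fun _ => ℝ) y' 0 k)) ^ ρ j)) := by
  set T : (Fin n → ℝ) → ℝ := fun y => (∏ i, trop (a i) (fun k => exp (Fin.snoc (α := fun _ => ℝ) y 0 k)) ^ ν i) /
    ∏ j, trop (b j) (fun k => exp (Fin.snoc (α := fun _ => ℝ) y 0 k)) ^ ρ j with hT
  set F : (Fin n → ℝ) → ℝ := fun y => (∏ i, |eval (fun k => exp (Fin.snoc (α := fun _ => ℝ) y 0 k)) (a i)| ^ ν i) /
    ∏ j, |eval (fun k => exp (Fin.snoc (α := fun _ => ℝ) y 0 k)) (b j)| ^ ρ j with hF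
  have hTpos : ∀ y, 0 < T y := fun y =>
    div_pos (Finset.prod_pos fun i _ => Real.rpow_pos_of_pos (trop_pos (fun _ => exp_pos _) (ha i)) _)
      (Finset.prod_pos fun j _ => Real.rpow_pos_of_pos (trop_pos (fun _ => exp_pos _) (hb j)) _)
  have hTm : Measurable T := by
    have hfv : ∀ p : MvPolynomial (Fin (n + 1)) ℝ, p ≠ 0 →
        Continuous fun y : Fin n → ℝ => trop p (fun k => exp (Fin.snoc (α := fun _ => ℝ) y 0 k)) := by
      intro p hp
      have h : (fun y : Fin n → ℝ => trop p (fun k => exp (Fin.snoc (α := fun _ => ℝ) y 0 k))) =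
          fun y => exp (faceValue p (Fin.snoc (α := fun _ => ℝ) y 0)) := funext fun y => trop_exp hp _
      rw [h]
      refine continuous_exp.comp ((continuous_faceValue hp).comp ?_)
      refine continuous_pi fun k => ?_
      refine Fin.lastCases ?_ (fun i => ?_) k
      · simp only [Fin.snoc_last]
        exact continuous_const
      · simp only [Fin.snoc_castSucc]
        exact continuous_apply i
    refine Continuous.measurable ?_
    exact (continuous_finsetProd _ fun i _ => (hfv (a i) (ha i)).rpow_const fun _ => Or.inl
        (trop_pos (fun _ => exp_pos _) (ha i)).ne').div
      (continuous_finsetProd _ fun j _ => (hfv (b j) (hb j)).rpow_const fun _ => Or.inl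
        (trop_pos (fun _ => exp_pos _) (hb j)).ne')
      fun y => (Finset.prod_pos fun j _ => Real.rpow_pos_of_pos (trop_pos (fun _ => exp_pos _) (hb j)) _).ne'
  have hI : 0 < ∫ y, T y := integral_tropical_pos_of_gap a b ν ρ ha hb hε hgap
  have key := integral_mul_eq_integral_mul_integral_withDensity (vol := (volume : Measure (Fin n → ℝ))) hTm
    (fun y => (hTpos y).le) hI (fun y => F y / T y)
  have hTF : ∀ y, T y * (F y / T y) = F y := fun y => mul_div_cancel₀ _ (hTpos y).ne'
  simp only [hTF] at key
  exact key

end Literature.MathematicalPhysics.QuantumFieldTheory.Borinsky2020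

end
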